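import Literature.NumberTheory.DiophantineGeometry.BelyiMapSignatureTwoThreeSeven
import HarnessLib

/-!
# A covering of signature `(2, 3, 13)`: the `j`-map of `X₀(13)`, two genus-`0` substitutions and one Kummer layer

Topic: `Literature/NumberTheory/DiophantineGeometry`. Theorem-only file (no definition, no named
fact), the fifth of the chain `BelyiMapSignatureTwoThreeEven` (`(2, 3, 2m)`, dihedral seed),
`BelyiMapSignatureTwoThreeTriple` (`(2, 3, 3m)`, tetrahedral seed), `BelyiMapSignatureTwoThreeFive`
(`(2, 3, 5m)`, icosahedral seed), `BelyiMapSignatureTwoThreeSeven` (`(2, 3, 7)`, the `j`-map of `X₁(7)`)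
attached to the named fact `AbcWave0.darmonGranville1995_thm_2` and to Pasten's Lemma 6.10
(`Literature.NumberTheory.EllipticCurves.PastenShimura2024_lemma_6_10`). It constructs EXPLICITLY, in the
tree's function-field language and in exactly the shape consumed by
`finite_properSolutions_of_belyiMap_of_faltings` (`AbcDarmonGranvilleSignatureReduction`), a covering of
`ℙ¹` of signature `(2, 3, 13)` over a number field
(`AlgFunctionField.exists_belyiMap_signature_two_three_thirteen`), whence Darmon–Granville's Theorem 2
for every signature `(p, q, r)` with `2 ∣ p`, `3 ∣ q`, `13 ∣ r` — in particular `x² + y³ = z¹³` and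
`(r, 2, 3)` for every `r` divisible by `13` — modulo Faltings' theorem ONLY
(`finite_properSolutions_signature_two_three_thirteen_of_faltings`,
`finite_properSolutions_signature_thirteen_two_three_of_faltings`), and, with the four companions, for
every `r ≥ 7` having a prime factor in `{2, 3, 5, 7, 13}`
(`finite_properSolutions_signature_r_two_three_of_faltings_of_dvd`). No Riemann existence theorem is
used.

Why a new technique is needed. `Δ(2, 3, 13)` is perfect, so every covering of signature `(2, 3, 13)` has
non-solvable monodromy (a quotient of `Δ(2, 3, 13)` onto a group containing `PSL₂(𝔽₁₃)`), and a Kummer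
tower must start from a non-solvable RATIONAL seed. The seeds of the companions (`X₁(7)`, the
icosahedral quotient, …) are `j`-maps of genus-`0` modular quotients ramified UNIFORMLY over `j = 0` and
`j = 1728`; for level `13` no such quotient exists: the only genus-`0` quotient of `X(13)` is
`X₀(13) ≅ ℙ¹` (over `ℚ`), whose `j`-map of degree `14`,
`j = 𝔞 𝔟³/x`, `j - 1728 = 𝔠 𝔢²/x`,
`𝔞 = x² + 5x + 13`, `𝔟 = x⁴ + 7x³ + 20x² + 19x + 1`, `𝔠 = x² + 6x + 13`,
`𝔢 = x⁶ + 10x⁵ + 46x⁴ + 108x³ + 122x² + 38x - 1` (Klein 1879; Fricke; the **level-`13` identity**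
`𝔞 𝔟³ - 1728 x = 𝔠 𝔢²`, `thA_mul_thB_pow`, by `ring`), has TWO simple points over `j = 0` (the roots
`r₁,₂ = (-5 ± 3√-3)/2` of `𝔞`, elliptic points of order `3` of `Γ₀(13)`), TWO simple points over
`j = 1728` (the roots `-3 ± 2i` of `𝔠`), a cusp `x = 0` of width `1` and a cusp `x = ∞` of width `13`.
This file makes the ramification uniform by COMPOSING the seed with two genus-`0` substitutions defined
over `ℚ` and then adding one Kummer layer, and supplies the generic **pull-back calculus** that makes such
composite seeds tractable:

* (A) for `π ∈ K[x]` and coprime `A, B ∈ K[u]`, the homogenised pull-back `𝒩(π) = Σ πᵢ Aⁱ B^{d-i}`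
  (`= B^d π(A/B)`, the even companion's `aeval_pullback_eq`) is multiplicative (`pullback_mul`), prime to
  `B` (`isCoprime_pullback_right`) and to `A` when `π(0) ≠ 0` (`isCoprime_pullback_left`); coprimality
  transfers, `IsCoprime π σ → IsCoprime 𝒩(π) 𝒩(σ)` (`isCoprime_pullback`); and separability transfers
  (`pullback_separable_of_isCoprime`, the even companion's `pullback_separable` freed from "`π`
  irreducible" and from the critical values `{0, 1, ∞}`): if every irreducible factor of the Wronskian
  `A'B - AB'` divides `B` or `𝒩(S)` (the finite critical values of `A/B` are roots of `S`), then `𝒩(π)` is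
  separable for every separable `π` prime to `S`.

## The construction

1. (The conic.) `(x + 3)² + 4 = y²` is parametrised over `ℚ` by `x = (4 - 6v - v²)/(2v)`, a degree-`2`
   map `v ↦ x` with critical values exactly `-3 ± 2i`; the cusp `x = 0` pulls back to `v = -3 ± √13`.
2. (The Rédei twist of the `13`-th power map.) With `(u + √13)¹³ = 𝔄(u) + √13 𝔅(u)`
   (`𝔄 = Σ_{k even} C(13,k) 13^{k/2} u^{13-k}`, degree `13`; `𝔅 = Σ_{k odd} C(13,k) 13^{(k-1)/2} u^{13-k}`,
   degree `12`; integer coefficients `≤ 1.1 · 10⁸`), `R = 𝔄/𝔅 ∈ ℚ(u)` is conjugate over `ℚ(√13)` to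
   `w ↦ w¹³` and is branched exactly over `R = ±√13` (at `u = ±√13`, totally): the **norm identity**
   `𝔄² - 13 𝔅² = (u² - 13)¹³` (`rdA_sq_sub`) and the **Wronskian identity** `𝔄'𝔅 - 𝔄𝔅' = 13 (u² - 13)¹²`
   (`wronskian_rdA_rdB`), both by `ring`; `v = R - 3`.
3. (The composite.) `x(u) = 𝔑/𝔎`, `𝔑 = 13 𝔅² - 𝔄² = -(u² - 13)¹³`, `𝔎 = 2𝔅(𝔄 - 3𝔅)`, degree `26`, over
   `ℚ`: over `x = 0` the two points `u = ±√13` of index `13`; over `x = ∞` `26` simple points; over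
   `x = -3 ± 2i` `26` double points (`𝒩(𝔠) = 𝔔²`, `𝔔 = 𝔄² - 6𝔄𝔅 + 13𝔅²`, `pullback_thC`); unramified
   elsewhere (Wronskian `𝔑'𝔎 - 𝔑𝔎' = -26 (u² - 13)¹² 𝔔`, `wronskian_rdN_rdK`). Hence the composite seed
   `𝔤 = 𝒯²/(1728 𝔓¹³) = 1 - j(x(u))/1728` (`𝒯 = 𝔔 𝒩(𝔢)`, `𝔓 = (u² - 13) 𝔎`;
   `𝒯² = 𝒩(𝔞) 𝒩(𝔟)³ + 1728 𝔓¹³`, `seedM_klein`) of degree `364` has zeros of order `2`, zeros of `𝔤 - 1`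
   of order `3` (at `𝒩(𝔟) = 0`) and `1` (at the `52` roots of `𝒩(𝔞) = 𝔓₁(r₁) 𝔓₁(r₂)`,
   `𝔓₁(r) = 𝔑 - r 𝔎`), poles of order `13` UNIFORMLY (the `27` roots of `𝔓` and `u = ∞`), and is
   unramified over every other closed point (`seedM_cases`, `seedM_elsewhere` — the latter through the
   DOUBLE pull-back of a closed point, first along the level-`13` seed by the even companion's
   `pullback_separable`, then along `x(u)` by `pullback_separable_of_isCoprime`). The polynomial algebra
   is: six integral Bézout identities among `𝔞, 𝔟, 𝔠, 𝔢` and three for their separability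
   (`isCoprime_th`, `separable_th`), the two congruences `𝔅 ≡ 13⁶ 2¹²`, `𝔄 - 3𝔅 ≡ 13⁶ 2¹² (u - 3)`
   modulo `u² - 13` (`rdB_eq`, `rdA_sub_eq`), and everything else is generic in `(𝔄, 𝔅)` given the two
   identities (section `Structure`: coprimality and separability of `u² - 13`, `𝔅`, `𝔄 - 3𝔅`, `𝔔`, `𝔓`
   from the Wronskians) or follows from the `x`-level facts through the pull-back calculus
   (`seedM_factors`).
4. (The layer.) Over a field containing `ζ = ζ₃` the form `𝔞` splits, `r₁ = 3ζ - 1`, `r₂ = -3ζ - 4`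
   (`thA_eq_mul`), and ONE Kummer layer of degree `3`, `F₁ = K(u)(w)`, `w³ = 𝔥 = 𝔓₁(r₁) 𝔓₁(r₂)²`
   (degree `78 ≡ 0 mod 3`, so unramified at `u = ∞`), is totally ramified above the `52` simple points
   over `j = 0` (there `v(𝔥) ∈ {1, 2}`) and unramified everywhere else (`v(𝔥) ∈ {0, -78}`), by Stichtenoth
   Prop. 3.7.3 through the tree's `FunctionFieldRadicalLayerSignature` and the two-layer companion's
   `PlaceOver.ord_algebraMap_eq_of_forall_ord_pos_mixed`. Hence `𝔤 ∈ F₁` has signature `(2, 3, 13)`: a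
   covering of degree `1092 = |PSL₂(𝔽₁₃)|` and genus `50`, the degree, genus and signature of
   `X(13) → X(1)`; finally `K` is replaced by the full constant field of `F₁`
   (`exists_fullConstantField_of_signature`).

All identities were checked beforehand in exact integer arithmetic. Implementation notes: the forms are
local notations with fully ascribed leaves; the seed section is generic in a pair `(a, b)` satisfying the
bundled hypothesis `RD(a, b)` (degrees, the two identities, the two congruences) and is instantiated with
`(𝔄, 𝔅)` only in the covering theorem (`rd_hyp`), so that no tactic ever unfolds the degree-`13`
literals; statements about the seed abstract `𝔤` and `𝔥` into variables `g, h` with defining equations.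

## References

* F. Klein, *Über die Transformation der elliptischen Functionen und die Auflösung der Gleichungen
  fünften Grades*, Math. Ann. 14 (1879) 111–172 (the transformation of order `13`: the Hauptmodul `τ` of
  `Γ₀(13)` with `J : J - 1 : 1 = (τ²+5τ+13)(τ⁴+7τ³+20τ²+19τ+1)³ : (τ²+6τ+13)(τ⁶+10τ⁵+46τ⁴+108τ³+122τ²+38τ-1)² : 1728τ`).
* R. S. Maier, *On rationally parametrized modular equations*, J. Ramanujan Math. Soc. 24 (2009)
  1–73 (the Hauptmodul of `Γ₀(13)` and its covering `j`; arXiv:math/0611041).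
* L. Rédei, *Über eindeutig umkehrbare Polynome in endlichen Körpern*, Acta Sci. Math. (Szeged) 11
  (1946) 85–92 (the rational functions `((u+√d)ⁿ ± (u-√d)ⁿ)`-quotients conjugate to `wⁿ`).
* H. Darmon, A. Granville, *On the equations `z^m = F(x, y)` and `A x^p + B y^q = C z^r`*, Bull. London
  Math. Soc. 27 (1995) 513–543: Theorem 2 (p. 515), Prop. 3.1 (p. 525). [DarmonGranville1995]
* H. Stichtenoth, *Algebraic Function Fields and Codes*, GTM 254, 2009: Prop. 3.7.3 (Kummer
  extensions), Thm. 3.1.11, Prop. 1.1.5, Cor. 1.1.20. [Stichtenoth2009]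
* H. Pasten, *Shimura curves and the abc conjecture*, J. Number Theory 254 (2024) 214–335
  (arXiv:1705.09251), §6.5, Lemma 6.10. [PastenShimura2024]
-/

noncomputable section

open scoped Classical Polynomial IntermediateField

namespace Literature.NumberTheory.DiophantineGeometry

open Polynomial

universe u v

namespace AlgFunctionField

/-! ### A. The pull-back calculus along a rational function `A/B` -/

/-- The homogenised pull-back `𝒩(π, A, B) = Σ_{i ≤ deg π} πᵢ Aⁱ B^{deg π - i} = B^{deg π} π(A/B)` of
`π ∈ K[X]` along `A/B` (local notation for the sum of `aeval_pullback_eq`, `pullback_separable`). -/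
local notation3 "𝒩(" π ", " A ", " B ")" =>
  (∑ i ∈ Finset.range (Polynomial.natDegree π + 1),
    Polynomial.C (Polynomial.coeff π i) * A ^ i * B ^ (Polynomial.natDegree π - i))

section PullbackCalculus

variable {K : Type u} [Field K]

/-- On the line, `aeval u` is the (injective) structure map `K[X] → K(u)`. [folklore] -/
theorem aeval_ratFunc_X_eq (p : K[X]) : aeval (RatFunc.X : RatFunc K) p = algebraMap K[X] (RatFunc K) p :=
  RatFunc.aeval_X_left_eq_algebraMap p

/-- Two polynomials with the same image on the line are equal. [folklore] -/
theorem eq_of_aeval_ratFunc_X_eq {p q : K[X]}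
    (h : aeval (RatFunc.X : RatFunc K) p = aeval (RatFunc.X : RatFunc K) q) : p = q := by
  rw [aeval_ratFunc_X_eq, aeval_ratFunc_X_eq] at h
  exact IsFractionRing.injective K[X] (RatFunc K) h

/-- **Multiplicativity of the pull-back**: `𝒩(π σ) = 𝒩(π) 𝒩(σ)` (`π, σ, B ≠ 0`). [folklore] -/
theorem pullback_mul {π σ A B : K[X]} (hπ : π ≠ 0) (hσ : σ ≠ 0) (hB : B ≠ 0) :
    𝒩(π * σ, A, B) = 𝒩(π, A, B) * 𝒩(σ, A, B) := by
  apply eq_of_aeval_ratFunc_X_eq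
  have hBu : aeval (RatFunc.X : RatFunc K) B ≠ 0 := aeval_ratFunc_X_ne_zero hB
  rw [map_mul, aeval_pullback_eq (π * σ) A B hBu, aeval_pullback_eq π A B hBu,
    aeval_pullback_eq σ A B hBu, natDegree_mul hπ hσ, map_mul, pow_add]
  ring

/-- The pull-back of a non-zero constant is that constant. [folklore] -/
theorem pullback_C (c : K) (A B : K[X]) : 𝒩(C c, A, B) = C c := by
  simp [natDegree_C]

/-- The pull-back of `X` is `A`. [folklore] -/
theorem pullback_X (A B : K[X]) : 𝒩((X : K[X]), A, B) = A := by
  simp [natDegree_X, coeff_X]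

/-- The pull-back of `X - c` is `A - c B`. [folklore] -/
theorem pullback_X_sub_C (c : K) (A B : K[X]) : 𝒩((X - C c : K[X]), A, B) = A - C c * B := by
  simp [Finset.sum_range_succ, coeff_X, coeff_C]
  ring

/-- **The pull-back does not vanish on the line** (`π ≠ 0`, `B ≠ 0`, `A/B` transcendental, i.e.
`deg A ≠ deg B` suffices here: we assume `A(u)/B(u) ∉ K`). [folklore] -/
theorem pullback_ne_zero {π A B : K[X]} (hπ : π ≠ 0) (hB : B ≠ 0)
    (htr : Transcendental K (aeval (RatFunc.X : RatFunc K) A / aeval (RatFunc.X : RatFunc K) B)) :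
    𝒩(π, A, B) ≠ 0 := by
  intro h
  have hBu : aeval (RatFunc.X : RatFunc K) B ≠ 0 := aeval_ratFunc_X_ne_zero hB
  have h1 := aeval_pullback_eq π A B hBu
  rw [h, map_zero] at h1
  have h2 : aeval (aeval (RatFunc.X : RatFunc K) A / aeval (RatFunc.X : RatFunc K) B) π = 0 :=
    (mul_eq_zero.mp h1.symm).resolve_left (pow_ne_zero _ hBu)
  exact htr ⟨π, hπ, h2⟩

/-- **The degree of the pull-back**: `deg 𝒩(π) = deg π · deg A` when `deg B < deg A`. [folklore] -/
theorem natDegree_pullback {π A B : K[X]} (hπ : π ≠ 0) (hAB : B.natDegree < A.natDegree) :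
    (𝒩(π, A, B)).natDegree = π.natDegree * A.natDegree := by
  have hlc : π.coeff π.natDegree ≠ 0 := leadingCoeff_ne_zero.mpr hπ
  have hlead : (C (π.coeff π.natDegree) * A ^ π.natDegree * B ^ (π.natDegree - π.natDegree)).natDegree =
      π.natDegree * A.natDegree := by
    rw [Nat.sub_self, pow_zero, mul_one, natDegree_C_mul hlc, natDegree_pow]
  rcases Nat.eq_zero_or_pos π.natDegree with h0 | hpos
  · rw [h0]
    simp
  have hA : 0 < A.natDegree := by omega
  have hrest : (∑ i ∈ Finset.range π.natDegree,
      C (π.coeff i) * A ^ i * B ^ (π.natDegree - i)).natDegree < π.natDegree * A.natDegree := by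
    have hle : (∑ i ∈ Finset.range π.natDegree,
        C (π.coeff i) * A ^ i * B ^ (π.natDegree - i)).natDegree ≤ π.natDegree * A.natDegree - 1 := by
      refine natDegree_sum_le_of_forall_le _ _ fun i hi => ?_
      have hid : i < π.natDegree := Finset.mem_range.mp hi
      obtain ⟨k, hk⟩ := Nat.exists_eq_add_of_lt hid
      calc (C (π.coeff i) * A ^ i * B ^ (π.natDegree - i)).natDegree
          ≤ (C (π.coeff i) * A ^ i).natDegree + (B ^ (π.natDegree - i)).natDegree := natDegree_mul_le
        _ ≤ ((C (π.coeff i)).natDegree + (A ^ i).natDegree) + (B ^ (π.natDegree - i)).natDegree := by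
            gcongr; exact natDegree_mul_le
        _ ≤ (0 + i * A.natDegree) + (π.natDegree - i) * B.natDegree := by
            gcongr
            · exact (natDegree_C _).le
            · exact natDegree_pow_le
            · exact natDegree_pow_le
        _ ≤ π.natDegree * A.natDegree - 1 := by
            rw [hk, show i + k + 1 - i = k + 1 by omega]
            have h1 : (k + 1) * B.natDegree + (k + 1) ≤ (k + 1) * A.natDegree := by nlinarith
            have h2 : (i + k + 1) * A.natDegree = i * A.natDegree + (k + 1) * A.natDegree := by ring
            omega
    have h3 : 1 ≤ π.natDegree * A.natDegree := Nat.mul_pos hpos hA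
    omega
  rw [Finset.sum_range_succ, natDegree_add_eq_right_of_natDegree_lt (by rw [hlead]; exact hrest), hlead]

variable [CharZero K]

omit [CharZero K] in
/-- **The pull-back is prime to `B`** (`A, B` coprime, `π ≠ 0`): modulo `B` it is `lc(π) A^{deg π}`.
[folklore] -/
theorem isCoprime_pullback_right {π A B : K[X]} (hπ : π ≠ 0) (hAB : IsCoprime A B) :
    IsCoprime 𝒩(π, A, B) B := by
  set d := π.natDegree with hd
  have hsplit : 𝒩(π, A, B) = C (π.coeff d) * A ^ d +
      B * ∑ i ∈ Finset.range d, C (π.coeff i) * A ^ i * B ^ (d - 1 - i) := by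
    rw [Finset.sum_range_succ, Nat.sub_self, pow_zero, mul_one, add_comm, Finset.mul_sum]
    congr 1
    refine Finset.sum_congr rfl fun i hi => ?_
    have hid : i < d := Finset.mem_range.mp hi
    rw [show d - i = (d - 1 - i) + 1 by omega, pow_succ]
    ring
  rw [hsplit]
  refine IsCoprime.add_mul_left_left ?_ _
  have hu : IsUnit (C (π.coeff d)) := isUnit_C.mpr
    ((leadingCoeff_ne_zero.mpr hπ).isUnit)
  exact (isCoprime_mul_unit_left_left hu (A ^ d) B).mpr hAB.pow_left

omit [CharZero K] in
/-- **The pull-back is prime to `A`** when `π(0) ≠ 0` (`A, B` coprime): modulo `A` it is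
`π(0) B^{deg π}`. [folklore] -/
theorem isCoprime_pullback_left {π A B : K[X]} (h0 : π.eval 0 ≠ 0) (hAB : IsCoprime A B) :
    IsCoprime 𝒩(π, A, B) A := by
  set d := π.natDegree with hd
  have hsplit : 𝒩(π, A, B) = C (π.coeff 0) * B ^ d +
      A * ∑ i ∈ Finset.range d, C (π.coeff (i + 1)) * A ^ i * B ^ (d - (i + 1)) := by
    rw [Finset.sum_range_succ', pow_zero, mul_one, Nat.sub_zero, add_comm, Finset.mul_sum]
    congr 1
    refine Finset.sum_congr rfl fun i hi => ?_
    rw [pow_succ]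
    ring
  rw [hsplit]
  refine IsCoprime.add_mul_left_left ?_ _
  have hc : π.coeff 0 ≠ 0 := by rwa [coeff_zero_eq_eval_zero]
  have hu : IsUnit (C (π.coeff 0)) := isUnit_C.mpr hc.isUnit
  exact (isCoprime_mul_unit_left_left hu (B ^ d) A).mpr hAB.symm.pow_left

omit [CharZero K] in
/-- **Coprimality transfers along the pull-back**: `π, σ` coprime and `A, B` coprime imply
`𝒩(π), 𝒩(σ)` coprime — a common prime factor `ρ` is prime to `B`, and then `θ = A/B mod ρ` would be
a common root of `π` and `σ`. [folklore] -/
theorem isCoprime_pullback {π σ A B : K[X]} (hπσ : IsCoprime π σ) (hAB : IsCoprime A B) (hπ : π ≠ 0)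
    (hN : 𝒩(π, A, B) ≠ 0) : IsCoprime 𝒩(π, A, B) 𝒩(σ, A, B) := by
  refine isCoprime_of_irreducible_dvd (fun h => hN h.1) fun ρ hρ hρπ hρσ => ?_
  · have hρB : ¬ ρ ∣ B := fun h =>
      hρ.not_isUnit ((isCoprime_pullback_right hπ hAB).isUnit_of_dvd' hρπ h)
    haveI := Fact.mk hρ
    have hb : aeval (AdjoinRoot.root ρ) B ≠ 0 := by
      rw [AdjoinRoot.aeval_eq, Ne, AdjoinRoot.mk_eq_zero]; exact hρB
    set θ : AdjoinRoot ρ := aeval (AdjoinRoot.root ρ) A / aeval (AdjoinRoot.root ρ) B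
    have hroot : ∀ τ : K[X], ρ ∣ 𝒩(τ, A, B) → aeval θ τ = 0 := fun τ hτ => by
      have h : aeval (AdjoinRoot.root ρ) 𝒩(τ, A, B) = 0 := by
        rw [AdjoinRoot.aeval_eq, AdjoinRoot.mk_eq_zero]; exact hτ
      rw [aeval_pullback_eq τ A B hb] at h
      exact (mul_eq_zero.mp h).resolve_left (pow_ne_zero _ hb)
    obtain ⟨a, b, hab⟩ := hπσ
    have key := congr_arg (aeval θ) hab
    rw [map_add, map_mul, map_mul, hroot π hρπ, hroot σ hρσ, mul_zero, mul_zero, add_zero, map_one] at key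
    exact zero_ne_one key

omit [CharZero K] in
/-- `π(θ) = 0` in `K[X]/(ρ)` for `θ = A/B mod ρ` whenever `ρ ∣ 𝒩(π)` and `ρ ∤ B`. [folklore] -/
theorem aeval_eq_zero_of_dvd_pullback {ρ : K[X]} [Fact (Irreducible ρ)] {π A B : K[X]}
    (hb : aeval (AdjoinRoot.root ρ) B ≠ 0) (h : ρ ∣ 𝒩(π, A, B)) :
    aeval (aeval (AdjoinRoot.root ρ) A / aeval (AdjoinRoot.root ρ) B) π = 0 := by
  have h1 : aeval (AdjoinRoot.root ρ) 𝒩(π, A, B) = 0 := by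
    rw [AdjoinRoot.aeval_eq, AdjoinRoot.mk_eq_zero]; exact h
  rw [aeval_pullback_eq π A B hb] at h1
  exact (mul_eq_zero.mp h1).resolve_left (pow_ne_zero _ hb)

/-- **Separability transfers along the pull-back** (the tool `pullback_separable` of the even companion,
freed from `π₀` irreducible and from the critical values `{0, 1, ∞}`). Let `A, B ∈ K[X]` be coprime
(`char K = 0`), `S ∈ K[X]`, and suppose every irreducible factor of the Wronskian `W = A'B - AB'`
divides `B` or the pull-back `𝒩(S)` (the finite critical values of `A/B` are roots of `S`). Then for
every separable `π` prime to `S` the pull-back `𝒩(π)`, if non-zero, is separable. Proof: if `ρ² ∣ 𝒩(π)`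
with `ρ` irreducible then `ρ ∤ B` (else `ρ ∣ lc(π) A^d`), so `θ = A/B mod ρ` is a root of `π`; from
`ρ ∣ 𝒩(π)'` and `B 𝒩' - d B' 𝒩 = W M̃` either `ρ ∣ M̃`, i.e. `π'(θ) = 0`, contradicting the separability
of `π`, or `ρ ∣ W`, whence `S(θ) = 0`, contradicting `IsCoprime π S`. [folklore] -/
theorem pullback_separable_of_isCoprime {A B S π : K[X]} (hsep : π.Separable) (hπS : IsCoprime π S)
    (hAB : IsCoprime A B)
    (hW : ∀ ρ : K[X], Irreducible ρ → ρ ∣ derivative A * B - A * derivative B → ρ ∣ B ∨ ρ ∣ 𝒩(S, A, B))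
    (hN0 : 𝒩(π, A, B) ≠ 0) : (𝒩(π, A, B)).Separable := by
  have hπ0 : π ≠ 0 := hsep.ne_zero
  rcases Nat.eq_zero_or_pos π.natDegree with hd0 | hdpos
  · -- `π` is a non-zero constant, and so is its pull-back
    obtain ⟨c, hc⟩ := natDegree_eq_zero.mp hd0
    have hc0 : c ≠ 0 := by rintro rfl; exact hπ0 (by rw [← hc, map_zero])
    rw [← hc, pullback_C]
    exact separable_C c |>.mpr hc0.isUnit
  set d := π.natDegree with hd
  set N : K[X] := 𝒩(π, A, B) with hN
  rw [PerfectField.separable_iff_squarefree]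
  intro x hx
  by_contra hxu
  have hx0 : x ≠ 0 := by
    rintro rfl
    exact hN0 (zero_dvd_iff.mp (dvd_trans (dvd_mul_right 0 0) hx))
  obtain ⟨ρ, hρ, hρx⟩ := WfDvdMonoid.exists_irreducible_factor hxu hx0
  have hρN2 : ρ * ρ ∣ N := (mul_dvd_mul hρx hρx).trans hx
  have hρN : ρ ∣ N := (dvd_mul_right ρ ρ).trans hρN2
  have hρN' : ρ ∣ derivative N := by
    obtain ⟨g, hg⟩ := hρN2
    rw [hg, derivative_mul, derivative_mul]
    exact dvd_add (dvd_mul_of_dvd_left (dvd_add (dvd_mul_left _ _) (dvd_mul_right _ _)) _)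
      (dvd_mul_of_dvd_left (dvd_mul_right _ _) _)
  have hρp : Prime ρ := hρ.prime
  -- `ρ ∤ B`
  have hρB : ¬ ρ ∣ B := fun h =>
    hρ.not_isUnit ((isCoprime_pullback_right hπ0 hAB).isUnit_of_dvd' hρN h)
  -- the residue field `κ = K[X]/(ρ)` and `θ = A/B mod ρ`
  haveI := Fact.mk hρ
  have hb : aeval (AdjoinRoot.root ρ) B ≠ 0 := by
    rw [AdjoinRoot.aeval_eq, Ne, AdjoinRoot.mk_eq_zero]; exact hρB
  set θ : AdjoinRoot ρ := aeval (AdjoinRoot.root ρ) A / aeval (AdjoinRoot.root ρ) B with hθ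
  have hθroot : aeval θ π = 0 := aeval_eq_zero_of_dvd_pullback hb hρN
  -- `ρ ∣ W M̃`
  have hWM : ρ ∣ (derivative A * B - A * derivative B) *
      ∑ i ∈ Finset.range (d + 1), C (π.coeff i * i) * A ^ (i - 1) * B ^ (d - i) := by
    rw [← pullback_derivative_identity π A B]
    exact dvd_sub (dvd_mul_of_dvd_right hρN' _) (dvd_mul_of_dvd_right hρN _)
  rcases hρp.dvd_or_dvd hWM with hρW | hρM
  · -- `ρ ∣ W`: `S(θ) = 0`
    rcases hW ρ hρ hρW with hρB' | hρS
    · exact hρB hρB'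
    · have hS : aeval θ S = 0 := aeval_eq_zero_of_dvd_pullback hb hρS
      obtain ⟨a, b, hab⟩ := hπS
      have key := congr_arg (aeval θ) hab
      rw [map_add, map_mul, map_mul, hθroot, hS, mul_zero, mul_zero, add_zero, map_one] at key
      exact zero_ne_one key
  · -- `ρ ∣ M̃`: `π'(θ) = 0`
    have h : aeval (AdjoinRoot.root ρ)
        (∑ i ∈ Finset.range (d + 1), C (π.coeff i * i) * A ^ (i - 1) * B ^ (d - i)) = 0 := by
      rw [AdjoinRoot.aeval_eq, AdjoinRoot.mk_eq_zero]; exact hρM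
    rw [aeval_pullback_derivative_eq π A B hdpos.ne' hb] at h
    have h' : aeval θ (derivative π) = 0 := (mul_eq_zero.mp h).resolve_left (pow_ne_zero _ hb)
    exact hsep.aeval_derivative_ne_zero hθroot h'

omit [CharZero K] in
/-- **Separability of a product** is separability of the factors and their coprimality. [folklore] -/
theorem separable_mul_iff' {p q : K[X]} : (p * q).Separable ↔ p.Separable ∧ q.Separable ∧ IsCoprime p q :=
  ⟨fun h => ⟨h.of_mul_left, h.of_mul_right, h.isCoprime⟩, fun ⟨hp, hq, hpq⟩ => hp.mul hq hpq⟩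

omit [CharZero K] in
/-- From an integral Bézout identity `s p + t q = n` with `n ≠ 0` to `IsCoprime p q`. [folklore] -/
theorem isCoprime_of_eq_C_of_ne_zero {p q s t : K[X]} {n : K} (hn : n ≠ 0)
    (h : s * p + t * q = C n) : IsCoprime p q := by
  obtain ⟨i, hi⟩ := isUnit_C.mpr hn.isUnit
  refine ⟨(↑i⁻¹ : K[X]) * s, (↑i⁻¹ : K[X]) * t, ?_⟩
  rw [mul_assoc, mul_assoc, ← mul_add, h, ← hi, Units.inv_mul]

omit [CharZero K] in
/-- A non-zero constant is prime to everything. [folklore] -/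
theorem isCoprime_C_right' (p : K[X]) {c : K} (hc : c ≠ 0) : IsCoprime p (C c) := by
  simpa using (isCoprime_mul_unit_left_right (isUnit_C.mpr hc.isUnit) p 1).mpr isCoprime_one_right

omit [CharZero K] in
/-- Multiplying by a non-zero constant does not change coprimality (left slot). [folklore] -/
theorem isCoprime_C_mul_left_iff {p q : K[X]} {c : K} (hc : c ≠ 0) : IsCoprime (C c * p) q ↔ IsCoprime p q :=
  isCoprime_mul_unit_left_left (isUnit_C.mpr hc.isUnit) p q

omit [CharZero K] in
/-- Multiplying by a non-zero constant does not change coprimality (right slot). [folklore] -/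
theorem isCoprime_C_mul_right_iff {p q : K[X]} {c : K} (hc : c ≠ 0) : IsCoprime p (C c * q) ↔ IsCoprime p q :=
  isCoprime_mul_unit_left_right (isUnit_C.mpr hc.isUnit) p q

end PullbackCalculus



/-! ### B. The level-`13` forms `𝔞, 𝔟, 𝔠, 𝔢`: `j = 𝔞 𝔟³/x`, `j - 1728 = 𝔠 𝔢²/x` on `X₀(13)` -/

/-- `𝔞 = X² + 5 X + 13` (the two simple points of `X₀(13)` over `j = 0`; local notation). -/
local notation3 "𝔞(" K ")" =>
  ((X : Polynomial K) ^ (2 : ℕ) + (5 : Polynomial K) * (X : Polynomial K) + (13 : Polynomial K))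

/-- `𝔟 = X⁴ + 7 X³ + 20 X² + 19 X + 1` (the four triple points of `X₀(13)` over `j = 0`; local notation). -/
local notation3 "𝔟(" K ")" =>
  ((X : Polynomial K) ^ (4 : ℕ) + (7 : Polynomial K) * (X : Polynomial K) ^ (3 : ℕ) +
    (20 : Polynomial K) * (X : Polynomial K) ^ (2 : ℕ) + (19 : Polynomial K) * (X : Polynomial K) +
    (1 : Polynomial K))

/-- `𝔠 = X² + 6 X + 13` (the two simple points of `X₀(13)` over `j = 1728`; local notation). -/
local notation3 "𝔠(" K ")" =>
  ((X : Polynomial K) ^ (2 : ℕ) + (6 : Polynomial K) * (X : Polynomial K) + (13 : Polynomial K))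

/-- `𝔢 = X⁶ + 10 X⁵ + 46 X⁴ + 108 X³ + 122 X² + 38 X - 1` (the six double points of `X₀(13)` over
`j = 1728`; local notation). -/
local notation3 "𝔢(" K ")" =>
  ((X : Polynomial K) ^ (6 : ℕ) + (10 : Polynomial K) * (X : Polynomial K) ^ (5 : ℕ) +
    (46 : Polynomial K) * (X : Polynomial K) ^ (4 : ℕ) + (108 : Polynomial K) * (X : Polynomial K) ^ (3 : ℕ) +
    (122 : Polynomial K) * (X : Polynomial K) ^ (2 : ℕ) + (38 : Polynomial K) * (X : Polynomial K) -
    (1 : Polynomial K))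

section LevelThirteen

variable {K : Type u} [Field K]

/-- `deg 𝔞 = 2`, `deg 𝔟 = 4`, `deg 𝔠 = 2`, `deg 𝔢 = 6`. [folklore] -/
theorem natDegree_th : (𝔞(K)).natDegree = 2 ∧ (𝔟(K)).natDegree = 4 ∧ (𝔠(K)).natDegree = 2 ∧
    (𝔢(K)).natDegree = 6 := by
  refine ⟨?_, ?_, ?_, ?_⟩ <;> compute_degree!

/-- `𝔞, 𝔟, 𝔠, 𝔢 ≠ 0`. [folklore] -/
theorem th_ne_zero : 𝔞(K) ≠ 0 ∧ 𝔟(K) ≠ 0 ∧ 𝔠(K) ≠ 0 ∧ 𝔢(K) ≠ 0 := by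
  obtain ⟨ha, hb, hc, he⟩ := natDegree_th (K := K)
  refine ⟨fun h => ?_, fun h => ?_, fun h => ?_, fun h => ?_⟩
  · rw [h, natDegree_zero] at ha; exact absurd ha (by norm_num)
  · rw [h, natDegree_zero] at hb; exact absurd hb (by norm_num)
  · rw [h, natDegree_zero] at hc; exact absurd hc (by norm_num)
  · rw [h, natDegree_zero] at he; exact absurd he (by norm_num)

/-- `𝔞(0) = 13`, `𝔟(0) = 1`, `𝔠(0) = 13`, `𝔢(0) = -1`. [folklore] -/
theorem th_eval : (𝔞(K)).eval 0 = 13 ∧ (𝔟(K)).eval 0 = 1 ∧ (𝔠(K)).eval 0 = 13 ∧ (𝔢(K)).eval 0 = -1 := by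
  refine ⟨?_, ?_, ?_, ?_⟩ <;> norm_num

/-- **The level-`13` identity** `𝔞 𝔟³ - 1728 X = 𝔠 𝔢²`, i.e. `j - 1728 = 𝔠 𝔢²/X` for the `j`-map
`j = 𝔞 𝔟³/X` of `X₀(13)` (Klein; Fricke). [folklore] -/
theorem thA_mul_thB_pow : 𝔞(K) * 𝔟(K) ^ 3 - 1728 * X = 𝔠(K) * 𝔢(K) ^ 2 := by ring

/-- The derivative of `𝔠 𝔢²` against `X`: `X (𝔠 𝔢²)' - 𝔠 𝔢² = 13 𝔢 𝔟²` (the `j`-map of `X₀(13)` is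
ramified only over `j = 0, 1728, ∞`). [folklore] -/
theorem wronskian_th : X * derivative (𝔠(K) * 𝔢(K) ^ 2) - 𝔠(K) * 𝔢(K) ^ 2 = 13 * 𝔢(K) * 𝔟(K) ^ 2 := by
  simp only [derivative_mul, derivative_pow, derivative_add, derivative_sub,
    derivative_X, derivative_one, derivative_ofNat, Nat.cast_ofNat, zero_mul, zero_add, add_zero,
    sub_zero, mul_one, map_ofNat, Nat.add_one_sub_one]
  norm_num; ring

/-- **The Wronskian of `A₀ = 𝔠 𝔢²` and `B₀ = c X`**: `A₀' B₀ - A₀ B₀' = c · 13 𝔢 𝔟²`. [folklore] -/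
theorem wronskian_th' (c : K) :
    derivative (𝔠(K) * 𝔢(K) ^ 2) * (C c * X) - 𝔠(K) * 𝔢(K) ^ 2 * derivative (C c * X) =
      C c * (13 * 𝔢(K) * 𝔟(K) ^ 2) := by
  rw [derivative_C_mul_X, ← wronskian_th]; ring

/-- A polynomial not vanishing at `0` is prime to `X`. [folklore] -/
theorem isCoprime_X_of_eval_ne_zero {p : K[X]} (h : p.eval 0 ≠ 0) : IsCoprime p X := by
  obtain ⟨t, ht⟩ := X_dvd_sub_C (p := p)
  have e : p = C (p.eval 0) + X * t := by rw [← coeff_zero_eq_eval_zero, ← ht]; ring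
  have h1 : IsCoprime (C (p.eval 0)) X := by
    simpa using (isCoprime_mul_unit_left_left (isUnit_C.mpr h.isUnit) 1 X).mpr isCoprime_one_left
  rw [e]
  exact h1.add_mul_left_left t

variable [CharZero K]

/-- **Pairwise coprimality of `𝔞, 𝔟, 𝔠, 𝔢`** (six integral Bézout identities, e.g.
`(X³ + 2X² - 3X + 8) 𝔞 - X 𝔟 = 104`). [folklore] -/
theorem isCoprime_th : IsCoprime 𝔞(K) 𝔟(K) ∧ IsCoprime 𝔞(K) 𝔢(K) ∧ IsCoprime 𝔟(K) 𝔢(K) ∧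
    IsCoprime 𝔞(K) 𝔠(K) ∧ IsCoprime 𝔟(K) 𝔠(K) ∧ IsCoprime 𝔢(K) 𝔠(K) := by
  refine ⟨?_, ?_, ?_, ?_, ?_, ?_⟩
  · refine isCoprime_of_eq_C_of_ne_zero (s := X ^ 3 + 2 * X ^ 2 - 3 * X + 8) (t := -X) (n := 104) (by norm_num) ?_
    rw [map_ofNat]; ring
  · refine isCoprime_of_eq_C_of_ne_zero (s := -2 * X ^ 5 - 15 * X ^ 4 - 41 * X ^ 3 - 46 * X ^ 2 - 21 * X + 17)
      (t := 2 * X + 5) (n := 216) (by norm_num) ?_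
    rw [map_ofNat]; ring
  · refine isCoprime_of_eq_C_of_ne_zero (s := 2 * X ^ 5 + 19 * X ^ 4 + 84 * X ^ 3 + 186 * X ^ 2 + 193 * X + 44)
      (t := -2 * X ^ 3 - 13 * X ^ 2 - 35 * X - 28) (n := 72) (by norm_num) ?_
    rw [map_ofNat]; ring
  · refine isCoprime_of_eq_C_of_ne_zero (s := X + 6) (t := -X - 5) (n := 13) (by norm_num) ?_
    rw [map_ofNat]; ring
  · refine isCoprime_of_eq_C_of_ne_zero (s := -1) (t := X ^ 2 + X + 1) (n := 12) (by norm_num) ?_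
    rw [map_ofNat]; ring
  · refine isCoprime_of_eq_C_of_ne_zero (s := -3 * X - 13)
      (t := 3 * X ^ 5 + 25 * X ^ 4 + 79 * X ^ 3 + 123 * X ^ 2 + 5 * X + 71) (n := 936) (by norm_num) ?_
    rw [map_ofNat]; ring

/-- **`𝔞`, `𝔟`, `𝔢` are separable** (Bézout identities with the derivatives, denominators
`27, 312, 2808`). [folklore] -/
theorem separable_th : (𝔞(K)).Separable ∧ (𝔟(K)).Separable ∧ (𝔢(K)).Separable := by
  refine ⟨?_, ?_, ?_⟩
  · rw [separable_def]
    refine isCoprime_of_eq_C_of_ne_zero (s := 4) (t := -2 * X - 5) (n := 27) (by norm_num) ?_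
    simp only [derivative_add, derivative_mul, derivative_X_pow, derivative_X, derivative_ofNat,
      Nat.cast_ofNat, zero_mul, zero_add, add_zero, mul_one, map_ofNat]
    norm_num; ring
  · rw [separable_def]
    refine isCoprime_of_eq_C_of_ne_zero (s := -28 * X ^ 2 - 103 * X - 125) (t := 7 * X ^ 3 + 38 * X ^ 2 + 82 * X + 23)
      (n := 312) (by norm_num) ?_
    simp only [derivative_add, derivative_mul, derivative_X_pow, derivative_X, derivative_ofNat,
      derivative_one, Nat.cast_ofNat, zero_mul, zero_add, add_zero, mul_one, map_ofNat]
    norm_num; ring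
  · rw [separable_def]
    refine isCoprime_of_eq_C_of_ne_zero (s := -42 * X ^ 4 - 338 * X ^ 3 - 1158 * X ^ 2 - 1800 * X - 946)
      (t := 7 * X ^ 5 + 68 * X ^ 4 + 297 * X ^ 3 + 639 * X ^ 2 + 584 * X + 49) (n := 2808) (by norm_num) ?_
    simp only [derivative_add, derivative_sub, derivative_mul, derivative_X_pow, derivative_X,
      derivative_ofNat, derivative_one, Nat.cast_ofNat, zero_mul, zero_add, sub_zero, mul_one,
      map_ofNat]
    norm_num; ring

/-- `𝔞, 𝔟, 𝔠, 𝔢` are prime to `X`. [folklore] -/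
theorem isCoprime_th_X : IsCoprime 𝔞(K) X ∧ IsCoprime 𝔟(K) X ∧ IsCoprime 𝔠(K) X ∧ IsCoprime 𝔢(K) X := by
  obtain ⟨ha, hb, hc, he⟩ := th_eval (K := K)
  exact ⟨isCoprime_X_of_eval_ne_zero (by rw [ha]; norm_num),
    isCoprime_X_of_eval_ne_zero (by rw [hb]; norm_num),
    isCoprime_X_of_eval_ne_zero (by rw [hc]; norm_num),
    isCoprime_X_of_eval_ne_zero (by rw [he]; norm_num)⟩

omit [CharZero K] in
/-- **`𝔞` splits over a field with a primitive cube root of unity**: `X² + 5X + 13 = (X - r₁)(X - r₂)`,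
`r₁ = 3ζ - 1`, `r₂ = -3ζ - 4` (`r₁,₂ = (-5 ± 3√-3)/2`). [folklore] -/
theorem thA_eq_mul {ζ : K} (hζ : ζ ^ 2 + ζ + 1 = 0) :
    𝔞(K) = (X - C (3 * ζ - 1)) * (X - C (-3 * ζ - 4)) := by
  have hC : (C ζ) ^ 2 + C ζ + 1 = 0 := by
    have h := congr_arg (C : K → K[X]) hζ
    simpa only [map_add, map_pow, map_one, map_zero] using h
  simp only [map_sub, map_mul, map_neg, map_ofNat, map_one]
  linear_combination (9 : K[X]) * hC

/-- `r₁ ≠ r₂`, and `r₁, r₂ ≠ 0`. [folklore] -/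
theorem th_roots_ne {ζ : K} (hζ : ζ ^ 2 + ζ + 1 = 0) :
    (3 * ζ - 1 : K) ≠ -3 * ζ - 4 ∧ (3 * ζ - 1 : K) ≠ 0 ∧ (-3 * ζ - 4 : K) ≠ 0 := by
  refine ⟨fun h => ?_, fun h => ?_, fun h => ?_⟩
  · have h2 : (ζ : K) = -1 / 2 := by linear_combination h / 6
    rw [h2] at hζ; norm_num at hζ
  · have h2 : (ζ : K) = 1 / 3 := by linear_combination h / 3
    rw [h2] at hζ; norm_num at hζ
  · have h2 : (ζ : K) = -4 / 3 := by linear_combination -h / 3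
    rw [h2] at hζ; norm_num at hζ

end LevelThirteen


/-! ### C. Generic consequences of the norm and Wronskian identities of a Rédei pair `(a, b)` -/

section Structure

/-! Generic consequences of the two identities `a² - 13 b² = (X² - 13)¹³`, `a' b - a b' = 13 (X² - 13)¹²`
and of the two congruences `X² - 13 ∤ b`, `X² - 13 ∤ a - 3b` (instantiated below with `a = 𝔄`, `b = 𝔅`). -/

variable {K : Type u} [Field K] {a b : K[X]}

/-- The derivative of `X² - 13` is `2 X`. [folklore] -/
theorem derivative_X_sq_sub : derivative (X ^ 2 - 13 : K[X]) = 2 * X := by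
  simp only [derivative_sub, derivative_X_pow, derivative_ofNat, Nat.cast_ofNat, sub_zero, map_ofNat]
  norm_num

/-- `𝔑 = -(X² - 13)¹³ = 13 b² - a²`. [folklore] -/
theorem rdN_eq (h1 : a ^ 2 - 13 * b ^ 2 = (X ^ 2 - 13) ^ 13) : -(X ^ 2 - 13 : K[X]) ^ 13 = 13 * b ^ 2 - a ^ 2 := by
  linear_combination h1

/-- **`𝔔²` is the pull-back of `x² + 6x + 13`**: `𝔑² + 6 𝔑 𝔎 + 13 𝔎² = 𝔔²` for `𝔑 = -(X² - 13)¹³`,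
`𝔎 = 2b(a - 3b)`, `𝔔 = a² - 6ab + 13b²` (the `26` points of the `u`-line over `x = -3 ± 2i` are double).
[folklore] -/
theorem rdQ_sq (h1 : a ^ 2 - 13 * b ^ 2 = (X ^ 2 - 13) ^ 13) :
    (-(X ^ 2 - 13 : K[X]) ^ 13) ^ 2 + 6 * (-(X ^ 2 - 13 : K[X]) ^ 13) * (2 * b * (a - 3 * b)) +
      13 * (2 * b * (a - 3 * b)) ^ 2 = (a ^ 2 - 6 * a * b + 13 * b ^ 2) ^ 2 := by
  rw [rdN_eq h1]; ring

/-- **The Wronskian of `x(u) = 𝔑/𝔎`**: `𝔑' 𝔎 - 𝔑 𝔎' = -26 (X² - 13)¹² 𝔔`. [folklore] -/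
theorem wronskian_rdN_rdK (h1 : a ^ 2 - 13 * b ^ 2 = (X ^ 2 - 13) ^ 13)
    (h2 : derivative a * b - a * derivative b = 13 * (X ^ 2 - 13) ^ 12) :
    derivative (-(X ^ 2 - 13 : K[X]) ^ 13) * (2 * b * (a - 3 * b)) -
      (-(X ^ 2 - 13 : K[X]) ^ 13) * derivative (2 * b * (a - 3 * b)) =
      -26 * (X ^ 2 - 13) ^ 12 * (a ^ 2 - 6 * a * b + 13 * b ^ 2) := by
  rw [rdN_eq h1]
  simp only [derivative_sub, derivative_mul, derivative_pow, derivative_ofNat, Nat.cast_ofNat, zero_mul,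
    zero_add, Nat.add_one_sub_one, map_ofNat]
  linear_combination (-(2 : K[X]) * (a ^ 2 - 6 * a * b + 13 * b ^ 2)) * h2

/-- `b 𝔔' - 2 b' 𝔔 = 26 (X² - 13)¹² (a - 3b)` (for the separability of `𝔔`). [folklore] -/
theorem rdQ_wronskian (h2 : derivative a * b - a * derivative b = 13 * (X ^ 2 - 13) ^ 12) :
    b * derivative (a ^ 2 - 6 * a * b + 13 * b ^ 2) - 2 * derivative b * (a ^ 2 - 6 * a * b + 13 * b ^ 2) =
      26 * (X ^ 2 - 13) ^ 12 * (a - 3 * b) := by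
  simp only [derivative_sub, derivative_add, derivative_mul, derivative_pow, derivative_ofNat,
    Nat.cast_ofNat, zero_mul, zero_add, Nat.add_one_sub_one, map_ofNat]
  linear_combination (2 * (a - 3 * b)) * h2

variable [CharZero K]

/-- `deg (X² - 13) = 2`, `deg 𝔑 = 26`, and both are non-zero. [folklore] -/
theorem natDegree_rdN : (X ^ 2 - 13 : K[X]).natDegree = 2 ∧ (-(X ^ 2 - 13 : K[X]) ^ 13).natDegree = 26 ∧
    (X ^ 2 - 13 : K[X]) ≠ 0 ∧ (-(X ^ 2 - 13 : K[X]) ^ 13) ≠ 0 := by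
  have hD : (X ^ 2 - 13 : K[X]).natDegree = 2 := by compute_degree!
  have hD0 : (X ^ 2 - 13 : K[X]) ≠ 0 := fun h => by rw [h, natDegree_zero] at hD; exact absurd hD (by norm_num)
  refine ⟨hD, by rw [natDegree_neg, natDegree_pow, hD], hD0, neg_ne_zero.mpr (pow_ne_zero _ hD0)⟩

/-- Degrees and non-vanishing: `deg (a - 3b) = 13`, `deg 𝔎 = 25`, `deg 𝔔 = 26`; `a, b, a - 3b, 𝔎, 𝔔 ≠ 0`.
[folklore] -/
theorem natDegree_rdK (ha : a.natDegree = 13) (hb : b.natDegree = 12) :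
    (a - 3 * b).natDegree = 13 ∧ (2 * b * (a - 3 * b)).natDegree = 25 ∧
      (a ^ 2 - 6 * a * b + 13 * b ^ 2).natDegree = 26 ∧ a ≠ 0 ∧ b ≠ 0 ∧ a - 3 * b ≠ 0 ∧
      2 * b * (a - 3 * b) ≠ 0 ∧ a ^ 2 - 6 * a * b + 13 * b ^ 2 ≠ 0 := by
  have hA0 : a ≠ 0 := fun h => by rw [h, natDegree_zero] at ha; exact absurd ha (by norm_num)
  have hB0 : b ≠ 0 := fun h => by rw [h, natDegree_zero] at hb; exact absurd hb (by norm_num)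
  have h3B : (3 * b).natDegree ≤ 12 :=
    (natDegree_mul_le.trans (by rw [natDegree_ofNat, zero_add])).trans hb.le
  have h3 : (a - 3 * b).natDegree = 13 := by
    rw [sub_eq_add_neg, natDegree_add_eq_left_of_natDegree_lt, ha]
    rw [natDegree_neg, ha]; omega
  have h30 : a - 3 * b ≠ 0 := fun h => by rw [h, natDegree_zero] at h3; exact absurd h3 (by norm_num)
  have hK : (2 * b * (a - 3 * b)).natDegree = 25 := by
    rw [natDegree_mul (mul_ne_zero two_ne_zero hB0) h30, natDegree_mul two_ne_zero hB0, h3, hb,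
      natDegree_ofNat]
  have hK0 : 2 * b * (a - 3 * b) ≠ 0 := fun h => by rw [h, natDegree_zero] at hK; exact absurd hK (by norm_num)
  have h1' : (a ^ 2).natDegree = 26 := by rw [natDegree_pow, ha]
  have h2' : (6 * a * b).natDegree ≤ 25 := by
    calc (6 * a * b).natDegree ≤ (6 * a).natDegree + b.natDegree := natDegree_mul_le
      _ ≤ a.natDegree + b.natDegree := by
          gcongr; exact natDegree_mul_le.trans (by rw [natDegree_ofNat, zero_add])
      _ = 25 := by rw [ha, hb]
  have h4 : (13 * b ^ 2).natDegree ≤ 24 := by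
    calc (13 * b ^ 2).natDegree ≤ (b ^ 2).natDegree := natDegree_mul_le.trans (by rw [natDegree_ofNat, zero_add])
      _ ≤ 24 := by rw [natDegree_pow, hb]
  have hs : (a ^ 2 - 6 * a * b).natDegree = 26 := by
    rw [natDegree_sub_eq_left_of_natDegree_lt (by rw [h1']; omega), h1']
  have hQ : (a ^ 2 - 6 * a * b + 13 * b ^ 2).natDegree = 26 := by
    rw [natDegree_add_eq_left_of_natDegree_lt (by rw [hs]; omega), hs]
  have hQ0 : a ^ 2 - 6 * a * b + 13 * b ^ 2 ≠ 0 := fun h => by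
    rw [h, natDegree_zero] at hQ; exact absurd hQ (by norm_num)
  exact ⟨h3, hK, hQ, hA0, hB0, h30, hK0, hQ0⟩

/-- **`a` and `b` are coprime** (`a² = (X² - 13)¹³ + 13 b²`), hence so are `b` and `a - 3b`, and the
numerator `𝔑 = -(X² - 13)¹³` and the denominator `𝔎 = 2b(a - 3b)` of `x(u)`. [folklore] -/
theorem isCoprime_rdNK (h1 : a ^ 2 - 13 * b ^ 2 = (X ^ 2 - 13) ^ 13) (hDb : IsCoprime (X ^ 2 - 13 : K[X]) b)
    (hD3 : IsCoprime (X ^ 2 - 13 : K[X]) (a - 3 * b)) :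
    IsCoprime a b ∧ IsCoprime b (a - 3 * b) ∧ IsCoprime (X ^ 2 - 13 : K[X]) (2 * b * (a - 3 * b)) ∧
      IsCoprime (-(X ^ 2 - 13 : K[X]) ^ 13) (2 * b * (a - 3 * b)) := by
  have hsq : IsCoprime (a * a) b := by
    have e : a * a = (X ^ 2 - 13) ^ 13 + b * (13 * b) := by linear_combination h1
    rw [e]
    exact hDb.pow_left.add_mul_left_left _
  have hab : IsCoprime a b := hsq.of_mul_left_left
  have hb3 : IsCoprime b (a - 3 * b) := by
    have e : a - 3 * b = a + b * (-3) := by ring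
    rw [e]
    exact hab.symm.add_mul_left_right _
  have h2 : IsCoprime (X ^ 2 - 13 : K[X]) (2 * b) := by
    rw [show (2 : K[X]) = C (2 : K) by rw [map_ofNat], isCoprime_C_mul_right_iff two_ne_zero]; exact hDb
  have hDK : IsCoprime (X ^ 2 - 13 : K[X]) (2 * b * (a - 3 * b)) := h2.mul_right hD3
  refine ⟨hab, hb3, hDK, ?_⟩
  exact hDK.pow_left.neg_left

/-- **`𝔔` is prime to `b`, to `a - 3b` and to `X² - 13`** (`𝔔 = a(a - 6b) + 13b² = (a - 3b)² + 4b² =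
(X² - 13)¹³ + 2b(13b - 3a)`, and `(13b - 3a)(13b + 3a) = 52b² - 9(X² - 13)¹³`). [folklore] -/
theorem isCoprime_rdQ (h1 : a ^ 2 - 13 * b ^ 2 = (X ^ 2 - 13) ^ 13) (hDb : IsCoprime (X ^ 2 - 13 : K[X]) b)
    (hD3 : IsCoprime (X ^ 2 - 13 : K[X]) (a - 3 * b)) :
    IsCoprime (a ^ 2 - 6 * a * b + 13 * b ^ 2) b ∧ IsCoprime (a ^ 2 - 6 * a * b + 13 * b ^ 2) (a - 3 * b) ∧
      IsCoprime (a ^ 2 - 6 * a * b + 13 * b ^ 2) (X ^ 2 - 13) := by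
  obtain ⟨hab, hb3, -, -⟩ := isCoprime_rdNK h1 hDb hD3
  refine ⟨?_, ?_, ?_⟩
  · have e : a ^ 2 - 6 * a * b + 13 * b ^ 2 = a * (a + b * (-6)) + b * (13 * b) := by ring
    rw [e]
    exact (hab.mul_left (hab.symm.add_mul_left_right _).symm).add_mul_left_left _
  · have e : a ^ 2 - 6 * a * b + 13 * b ^ 2 = C (4 : K) * b ^ 2 + (a - 3 * b) * (a - 3 * b) := by
      rw [map_ofNat]; ring
    rw [e]
    refine IsCoprime.add_mul_left_left ?_ _
    rw [isCoprime_C_mul_left_iff (by norm_num)]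
    exact hb3.pow_left
  · have e : a ^ 2 - 6 * a * b + 13 * b ^ 2 = (X ^ 2 - 13) * (X ^ 2 - 13) ^ 12 + 2 * b * (13 * b - 3 * a) := by
      linear_combination h1
    have e2 : (13 * b - 3 * a) * (13 * b + 3 * a) = (X ^ 2 - 13) * (-9 * (X ^ 2 - 13) ^ 12) + C (52 : K) * b ^ 2 := by
      rw [map_ofNat]; linear_combination (-9 : K[X]) * h1
    have h52 : IsCoprime (X ^ 2 - 13 : K[X]) (C (52 : K) * b ^ 2) := by
      rw [isCoprime_C_mul_right_iff (by norm_num)]; exact hDb.pow_right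
    have h3 : IsCoprime (X ^ 2 - 13 : K[X]) (13 * b - 3 * a) := by
      have h4 : IsCoprime (X ^ 2 - 13 : K[X]) ((13 * b - 3 * a) * (13 * b + 3 * a)) := by
        rw [e2]; exact h52.mul_add_left_right _
      exact h4.of_mul_right_left
    have h2 : IsCoprime (X ^ 2 - 13 : K[X]) (2 * b) := by
      rw [show (2 : K[X]) = C (2 : K) by rw [map_ofNat], isCoprime_C_mul_right_iff two_ne_zero]; exact hDb
    rw [e]
    exact ((h2.mul_right h3).mul_add_left_right _).symm

/-- **Separability of `X² - 13`, `b`, `a - 3b` and `𝔔`** (from the Wronskian identities). [folklore] -/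
theorem separable_rd (ha : a.natDegree = 13) (hb : b.natDegree = 12)
    (h1 : a ^ 2 - 13 * b ^ 2 = (X ^ 2 - 13) ^ 13)
    (h2 : derivative a * b - a * derivative b = 13 * (X ^ 2 - 13) ^ 12)
    (hDb : IsCoprime (X ^ 2 - 13 : K[X]) b) (hD3 : IsCoprime (X ^ 2 - 13 : K[X]) (a - 3 * b)) :
    (X ^ 2 - 13 : K[X]).Separable ∧ b.Separable ∧ (a - 3 * b).Separable ∧
      (a ^ 2 - 6 * a * b + 13 * b ^ 2).Separable := by
  obtain ⟨-, -, -, -, hB0, h30, -, hQ0⟩ := natDegree_rdK ha hb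
  obtain ⟨-, hQ3, hQD⟩ := isCoprime_rdQ h1 hDb hD3
  have h13 : IsUnit (C (13 : K) : K[X]) := isUnit_C.mpr (by norm_num : (13 : K) ≠ 0).isUnit
  have h26 : IsUnit (C (26 : K) : K[X]) := isUnit_C.mpr (by norm_num : (26 : K) ≠ 0).isUnit
  have hD : (X ^ 2 - 13 : K[X]).Separable := by
    rw [separable_def, derivative_X_sq_sub]
    exact isCoprime_of_eq_C_of_ne_zero (s := -2) (t := X) (n := 26) (by norm_num) (by rw [map_ofNat]; ring)
  have key : ∀ ρ : K[X], Irreducible ρ → ρ ∣ C (13 : K) * (X ^ 2 - 13) ^ 12 → ρ ∣ (X ^ 2 - 13) :=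
    fun ρ hρ h => by
    rcases hρ.prime.dvd_or_dvd h with h | h
    · exact (hρ.not_isUnit (isUnit_of_dvd_unit h h13)).elim
    · exact hρ.prime.dvd_of_dvd_pow h
  have ew : C (13 : K) * (X ^ 2 - 13) ^ 12 = derivative a * b - a * derivative b := by rw [h2, map_ofNat]
  refine ⟨hD, ?_, ?_, ?_⟩
  · rw [separable_def]
    refine isCoprime_of_irreducible_dvd (fun h => hB0 h.1) fun ρ hρ hl hr => ?_
    have h5 : ρ ∣ C (13 : K) * (X ^ 2 - 13) ^ 12 := by
      rw [ew]; exact dvd_sub (dvd_mul_of_dvd_right hl _) (dvd_mul_of_dvd_right hr _)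
    exact hρ.not_isUnit (hDb.isUnit_of_dvd' (key ρ hρ h5) hl)
  · rw [separable_def]
    refine isCoprime_of_irreducible_dvd (fun h => h30 h.1) fun ρ hρ hl hr => ?_
    have h5 : ρ ∣ C (13 : K) * (X ^ 2 - 13) ^ 12 := by
      have e : C (13 : K) * (X ^ 2 - 13) ^ 12 = derivative (a - 3 * b) * b - (a - 3 * b) * derivative b := by
        rw [ew, derivative_sub, derivative_mul, derivative_ofNat, zero_mul, zero_add]; ring
      rw [e]; exact dvd_sub (dvd_mul_of_dvd_left hr _) (dvd_mul_of_dvd_left hl _)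
    exact hρ.not_isUnit (hD3.isUnit_of_dvd' (key ρ hρ h5) hl)
  · rw [separable_def]
    refine isCoprime_of_irreducible_dvd (fun h => hQ0 h.1) fun ρ hρ hl hr => ?_
    have h5 : ρ ∣ C (26 : K) * (X ^ 2 - 13) ^ 12 * (a - 3 * b) := by
      have e : C (26 : K) * (X ^ 2 - 13) ^ 12 * (a - 3 * b) =
          b * derivative (a ^ 2 - 6 * a * b + 13 * b ^ 2) -
            2 * derivative b * (a ^ 2 - 6 * a * b + 13 * b ^ 2) := by
        rw [rdQ_wronskian h2, map_ofNat]
      rw [e]; exact dvd_sub (dvd_mul_of_dvd_right hr _) (dvd_mul_of_dvd_right hl _)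
    rcases hρ.prime.dvd_or_dvd h5 with h | h
    · rcases hρ.prime.dvd_or_dvd h with h | h
      · exact hρ.not_isUnit (isUnit_of_dvd_unit h h26)
      · exact hρ.not_isUnit (hQD.isUnit_of_dvd' hl (hρ.prime.dvd_of_dvd_pow h))
    · exact hρ.not_isUnit (hQ3.isUnit_of_dvd' hl h)

/-! ### D. The Rédei forms `𝔄, 𝔅`: `(u + √13)¹³ = 𝔄 + √13 𝔅` -/

/-- **The pole form `𝔓 = (X² - 13) 𝔎` is separable**, and `deg 𝔓 = 27`. [folklore] -/
theorem separable_rdP (ha : a.natDegree = 13) (hb : b.natDegree = 12)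
    (h1 : a ^ 2 - 13 * b ^ 2 = (X ^ 2 - 13) ^ 13)
    (h2 : derivative a * b - a * derivative b = 13 * (X ^ 2 - 13) ^ 12)
    (hDb : IsCoprime (X ^ 2 - 13 : K[X]) b) (hD3 : IsCoprime (X ^ 2 - 13 : K[X]) (a - 3 * b)) :
    ((X ^ 2 - 13) * (2 * b * (a - 3 * b))).Separable ∧ ((X ^ 2 - 13) * (2 * b * (a - 3 * b))).natDegree = 27 ∧
      (X ^ 2 - 13) * (2 * b * (a - 3 * b)) ≠ 0 := by
  obtain ⟨hD, hB, h3, -⟩ := separable_rd ha hb h1 h2 hDb hD3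
  obtain ⟨-, hb3, hDK, -⟩ := isCoprime_rdNK h1 hDb hD3
  obtain ⟨-, hK, -, -, -, -, hK0, -⟩ := natDegree_rdK ha hb
  obtain ⟨hDd, -, hD0, -⟩ := natDegree_rdN (K := K)
  have h2B : ((2 : K[X]) * b).Separable := by
    rw [show (2 : K[X]) = C (2 : K) by rw [map_ofNat]]
    exact ((separable_C _).mpr (by norm_num : (2 : K) ≠ 0).isUnit).mul hB
      (isCoprime_C_right' b two_ne_zero).symm
  have h2b3 : IsCoprime ((2 : K[X]) * b) (a - 3 * b) := by
    rw [show (2 : K[X]) = C (2 : K) by rw [map_ofNat], isCoprime_C_mul_left_iff two_ne_zero]; exact hb3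
  exact ⟨hD.mul (h2B.mul h3 h2b3) hDK, by rw [natDegree_mul hD0 hK0, hDd, hK], mul_ne_zero hD0 hK0⟩

end Structure

local notation3 "𝔄(" K ")" =>
  ((X : Polynomial K) ^ (13 : ℕ) +
    (1014 : Polynomial K) * (X : Polynomial K) ^ (11 : ℕ) +
    (120835 : Polynomial K) * (X : Polynomial K) ^ (9 : ℕ) +
    (3770052 : Polynomial K) * (X : Polynomial K) ^ (7 : ℕ) +
    (36758007 : Polynomial K) * (X : Polynomial K) ^ (5 : ℕ) +
    (106189798 : Polynomial K) * (X : Polynomial K) ^ (3 : ℕ) +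
    (62748517 : Polynomial K) * (X : Polynomial K))

local notation3 "𝔅(" K ")" =>
  ((13 : Polynomial K) * (X : Polynomial K) ^ (12 : ℕ) +
    (3718 : Polynomial K) * (X : Polynomial K) ^ (10 : ℕ) +
    (217503 : Polynomial K) * (X : Polynomial K) ^ (8 : ℕ) +
    (3770052 : Polynomial K) * (X : Polynomial K) ^ (6 : ℕ) +
    (20421115 : Polynomial K) * (X : Polynomial K) ^ (4 : ℕ) +
    (28960854 : Polynomial K) * (X : Polynomial K) ^ (2 : ℕ) +
    (4826809 : Polynomial K))

local notation3 "𝔇(" K ")" => ((X : Polynomial K) ^ (2 : ℕ) - (13 : Polynomial K))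

section Redei

variable {K : Type u} [Field K]

/-- `deg 𝔄 = 13`. [folklore] -/
theorem natDegree_rdA : (𝔄(K)).natDegree = 13 := by compute_degree!

/-- **The norm identity** `𝔄² - 13 𝔅² = (X² - 13)¹³` (`= (u + √13)¹³ (u - √13)¹³`). [folklore] -/
theorem rdA_sq_sub : 𝔄(K) ^ 2 - 13 * 𝔅(K) ^ 2 = 𝔇(K) ^ 13 := by ring

/-- The derivative of `𝔄`. [folklore] -/
theorem derivative_rdA : derivative 𝔄(K) = 13 * X ^ 12 + 11154 * X ^ 10 + 1087515 * X ^ 8 +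
    26390364 * X ^ 6 + 183790035 * X ^ 4 + 318569394 * X ^ 2 + 62748517 := by
  simp only [derivative_add, derivative_mul, derivative_X_pow, derivative_X,
    derivative_ofNat, Nat.cast_ofNat, zero_mul, zero_add, map_ofNat]
  norm_num; ring

/-- The derivative of `𝔅`. [folklore] -/
theorem derivative_rdB : derivative 𝔅(K) = 156 * X ^ 11 + 37180 * X ^ 9 + 1740024 * X ^ 7 +
    22620312 * X ^ 5 + 81684460 * X ^ 3 + 57921708 * X := by
  simp only [derivative_add, derivative_mul, derivative_X_pow,
    derivative_ofNat, Nat.cast_ofNat, zero_mul, zero_add, map_ofNat]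
  norm_num; ring

/-- **The Wronskian identity** `𝔄' 𝔅 - 𝔄 𝔅' = 13 (X² - 13)¹²` (`R = 𝔄/𝔅` is the twist of `w ↦ w¹³`,
branched only at `u = ±√13`). [folklore] -/
theorem wronskian_rdA_rdB : derivative 𝔄(K) * 𝔅(K) - 𝔄(K) * derivative 𝔅(K) = 13 * 𝔇(K) ^ 12 := by
  rw [derivative_rdA, derivative_rdB]; ring

/-- The derivative of the norm identity: `2 𝔄 𝔄' - 26 𝔅 𝔅' = 26 X (X² - 13)¹²`. [folklore] -/
theorem derivative_rdA_sq_sub :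
    2 * 𝔄(K) * derivative 𝔄(K) - 26 * 𝔅(K) * derivative 𝔅(K) = 26 * X * 𝔇(K) ^ 12 := by
  rw [derivative_rdA, derivative_rdB]; ring

/-- `𝔅 ≡ 13⁶ 2¹²` modulo `X² - 13`. [folklore] -/
theorem rdB_eq : 𝔅(K) = 𝔇(K) * (13 * X ^ 10 + 3887 * X ^ 8 + 268034 * X ^ 6 + 7254494 * X ^ 4 +
    114729537 * X ^ 2 + 1520444835) + C (19770609664 : K) := by rw [map_ofNat]; ring

/-- `𝔄 - 3 𝔅 ≡ 13⁶ 2¹² (X - 3)` modulo `X² - 13`. [folklore] -/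
theorem rdA_sub_eq : 𝔄(K) - 3 * 𝔅(K) = 𝔇(K) * (X ^ 11 - 39 * X ^ 10 + 1027 * X ^ 9 - 11661 * X ^ 8 +
    134186 * X ^ 7 - 804102 * X ^ 6 + 5514470 * X ^ 5 - 21763482 * X ^ 4 + 108446117 * X ^ 3 -
    344188611 * X ^ 2 + 1515989319 * X - 4561334505) + C (19770609664 : K) * (X - 3) := by
  rw [map_ofNat]; ring


variable [CharZero K]

/-- `deg 𝔅 = 12`. [folklore] -/
theorem natDegree_rdB : (𝔅(K)).natDegree = 12 := by compute_degree!

/-- **`X² - 13` is prime to `𝔅` and to `𝔄 - 3 𝔅`** (`𝔅 ≡ 13⁶ 2¹²`, `𝔄 - 3𝔅 ≡ 13⁶ 2¹² (X - 3)`, and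
`(X + 3)(X - 3) - (X² - 13) = 4`). [folklore] -/
theorem isCoprime_rdD : IsCoprime 𝔇(K) 𝔅(K) ∧ IsCoprime 𝔇(K) (𝔄(K) - 3 * 𝔅(K)) := by
  have hc : (19770609664 : K) ≠ 0 := by norm_num
  constructor
  · rw [rdB_eq]
    exact (isCoprime_C_right' _ hc).mul_add_left_right _
  · rw [rdA_sub_eq]
    refine IsCoprime.mul_add_left_right (IsCoprime.mul_right (isCoprime_C_right' _ hc) ?_) _
    exact isCoprime_of_eq_C_of_ne_zero (s := -1) (t := X + 3) (n := 4) (by norm_num) (by rw [map_ofNat]; ring)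

end Redei


/-! ### E. The composite seed `𝔤 = 𝒯(u)²/(1728 𝔓(u)¹³) = 1 - j₁₃(x(u))/1728` on the line `K(u)` -/

section Seed

variable {K : Type u} [Field K] {a b : K[X]}

/-- The hypothesis bundle on `(a, b)`: degrees `13, 12`, the norm and Wronskian identities, and the two
congruences (instantiated with `(𝔄, 𝔅)` in `rd_hyp`; local notation). -/
local notation3 "RD(" a ", " b ")" => (Polynomial.natDegree a = 13 ∧ Polynomial.natDegree b = 12 ∧
    a ^ 2 - 13 * b ^ 2 = ((X : Polynomial _) ^ 2 - 13) ^ 13 ∧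
    derivative a * b - a * derivative b = 13 * ((X : Polynomial _) ^ 2 - 13) ^ 12 ∧
    IsCoprime ((X : Polynomial _) ^ 2 - 13) b ∧ IsCoprime ((X : Polynomial _) ^ 2 - 13) (a - 3 * b))

/-- `𝔑 = -(X² - 13)¹³`, the numerator of `x(u)` (local notation). -/
local notation3 "𝔑" => (-((X : K[X]) ^ (2 : ℕ) - (13 : K[X])) ^ (13 : ℕ))
/-- `𝔎 = 2 b (a - 3 b)`, the denominator of `x(u)` (local notation). -/
local notation3 "𝔎" => ((2 : K[X]) * b * (a - (3 : K[X]) * b))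
/-- `𝔔 = a² - 6 a b + 13 b²` (local notation). -/
local notation3 "𝔔" => (a ^ (2 : ℕ) - (6 : K[X]) * a * b + (13 : K[X]) * b ^ (2 : ℕ))
/-- The pole form `𝔓 = (X² - 13) 𝔎` (local notation). -/
local notation3 "𝔓" => (((X : K[X]) ^ (2 : ℕ) - (13 : K[X])) * ((2 : K[X]) * b * (a - (3 : K[X]) * b)))
/-- The pull-back `𝒩(π)` of an `x`-level form `π` along `x(u) = 𝔑/𝔎` (local notation). -/
local notation3 "𝒩(" π ")" => (∑ i ∈ Finset.range (Polynomial.natDegree π + 1),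
    Polynomial.C (Polynomial.coeff π i) * (-((X : K[X]) ^ (2 : ℕ) - (13 : K[X])) ^ (13 : ℕ)) ^ i *
      ((2 : K[X]) * b * (a - (3 : K[X]) * b)) ^ (Polynomial.natDegree π - i))
/-- `𝔓₁(r) = 𝔑 - r 𝔎`, the pull-back of `X - r` (local notation). -/
local notation3 "𝔓₁(" r ")" =>
  ((-((X : K[X]) ^ (2 : ℕ) - (13 : K[X])) ^ (13 : ℕ)) - Polynomial.C r * ((2 : K[X]) * b * (a - (3 : K[X]) * b)))
/-- Images on the line `K(u)` (local notation). -/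
local notation3 "⟪" p "⟫" => (aeval (RatFunc.X : RatFunc K) p)
/-- The composite seed `𝔤 = (𝔔 ℰ)(u)²/(1728 𝔓(u)¹³)`, `ℰ = 𝒩(𝔢)` (local notation). -/
local notation3 "𝔤" => (⟪(a ^ (2 : ℕ) - (6 : K[X]) * a * b + (13 : K[X]) * b ^ (2 : ℕ)) * 𝒩(𝔢(K))⟫ ^ (2 : ℕ) /
    (algebraMap K (RatFunc K) (1728 : K) *
      ⟪((X : K[X]) ^ (2 : ℕ) - (13 : K[X])) * ((2 : K[X]) * b * (a - (3 : K[X]) * b))⟫ ^ (13 : ℕ)))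
/-- The radicand `𝔥 = 𝔓₁(r₁) 𝔓₁(r₂)²` of the Kummer layer (local notation). -/
local notation3 "𝔥(" r₁ ", " r₂ ")" => (aeval (RatFunc.X : RatFunc K) (𝔓₁(r₁) * 𝔓₁(r₂) ^ (2 : ℕ)))

/-- **The level-`13` identity at a point**: `𝔞(x) 𝔟(x)³ - 1728 x = 𝔠(x) 𝔢(x)²`. [folklore] -/
theorem th_identity_aeval {S : Type v} [CommRing S] [Algebra K S] (x : S) :
    aeval x 𝔞(K) * aeval x 𝔟(K) ^ 3 - 1728 * x = aeval x 𝔠(K) * aeval x 𝔢(K) ^ 2 := by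
  simp only [map_add, map_sub, map_mul, map_pow, aeval_X, aeval_one, map_ofNat]
  ring

/-- `𝔠(x) = x² + 6 x + 13` at a point. [folklore] -/
theorem thC_aeval {S : Type v} [CommRing S] [Algebra K S] (x : S) :
    aeval x 𝔠(K) = x ^ 2 + 6 * x + 13 := by
  simp only [map_add, map_mul, map_pow, aeval_X, map_ofNat]

/-- Unpacking the degrees and non-vanishing from the bundle. [folklore] -/
theorem rd_basic [CharZero K] (H : RD(a, b)) :
    Polynomial.natDegree 𝔎 = 25 ∧ Polynomial.natDegree 𝔑 = 26 ∧ Polynomial.natDegree 𝔔 = 26 ∧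
      Polynomial.natDegree 𝔓 = 27 ∧ 𝔎 ≠ 0 ∧ 𝔑 ≠ 0 ∧ 𝔔 ≠ 0 ∧ 𝔓 ≠ 0 ∧ ((X : K[X]) ^ 2 - 13) ≠ 0 ∧
      IsCoprime 𝔑 𝔎 := by
  obtain ⟨ha, hb, h1, h2, hDb, hD3⟩ := H
  obtain ⟨-, hK, hQ, -, -, -, hK0, hQ0⟩ := natDegree_rdK ha hb
  obtain ⟨-, hN, hD0, hN0⟩ := natDegree_rdN (K := K)
  obtain ⟨-, hP, hP0⟩ := separable_rdP ha hb h1 h2 hDb hD3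
  obtain ⟨-, -, -, hNK⟩ := isCoprime_rdNK h1 hDb hD3
  exact ⟨hK, hN, hQ, hP, hK0, hN0, hQ0, hP0, hD0, hNK⟩

variable [CharZero K]

/-- **`x(u) = 𝔑(u)/𝔎(u)` has a pole at infinity, hence is transcendental over `K`**, and `𝔎(u) ≠ 0`.
[cite: Stichtenoth2009, Prop. 1.1.5(c), Cor. 1.1.20] -/
theorem rdx_transcendental (H : RD(a, b)) : ⟪𝔎⟫ ≠ 0 ∧ Transcendental K (⟪𝔑⟫ / ⟪𝔎⟫) := by
  obtain ⟨hK, hN, -, -, hK0, hN0, -⟩ := rd_basic H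
  have hut := RatFunc.transcendental_X (K := K)
  have hKu : ⟪𝔎⟫ ≠ 0 := aeval_ratFunc_X_ne_zero hK0
  have hNu : ⟪𝔑⟫ ≠ 0 := aeval_ratFunc_X_ne_zero hN0
  refine ⟨hKu, fun halg => ?_⟩
  obtain ⟨P, hP⟩ := exists_ord_pos_of_transcendental (K := K) (F := RatFunc K)
    (fun h => hut (IsAlgebraic.inv_iff.1 h))
  rw [P.ord_inv RatFunc.X_ne_zero] at hP
  have hneg : P.ord (RatFunc.X : RatFunc K) < 0 := by omega
  have hu1 := P.ord_eq_neg_one_of_finrank_eq_one hut (finrank_adjoin_ratFunc_X (K := K)) hneg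
  have hoN : P.ord ⟪𝔑⟫ = -26 := by rw [(P.ord_aeval_of_ord_neg hneg hN0).2, hN, hu1]; norm_num
  have hoK : P.ord ⟪𝔎⟫ = -25 := by rw [(P.ord_aeval_of_ord_neg hneg hK0).2, hK, hu1]; norm_num
  have hox : P.ord (⟪𝔑⟫ / ⟪𝔎⟫) = -1 := by rw [P.ord_div hNu hKu, hoN, hoK]; norm_num
  have hmem := IsAlgFunctionField.mem_valuationSubring_of_isAlgebraic P.toValuationSubring
    P.algebraMap_mem halg
  have := (P.mem_toValuationSubring_iff_ord_nonneg (div_ne_zero hNu hKu)).1 hmem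
  omega

/-- **`𝔔²` is the pull-back of `𝔠`**: `𝒩(𝔠) = 𝔔²`. [folklore] -/
theorem pullback_thC (H : RD(a, b)) : 𝒩(𝔠(K)) = 𝔔 ^ 2 := by
  have h1 := H.2.2.1
  obtain ⟨hKu, -⟩ := rdx_transcendental H
  apply eq_of_aeval_ratFunc_X_eq
  obtain ⟨-, -, hc, -⟩ := natDegree_th (K := K)
  rw [aeval_pullback_eq _ _ _ hKu, hc, ← rdQ_sq h1, thC_aeval]
  generalize ((X : K[X]) ^ 2 - 13) = Dp at hKu ⊢
  generalize (2 * b * (a - 3 * b)) = Kp at hKu ⊢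
  simp only [map_add, map_mul, map_pow, map_neg, map_ofNat]
  field_simp

/-- **The Klein-shaped identity of the composite seed**: `𝒯² = 𝒜 ℬ³ + 1728 𝔓¹³` with `𝒯 = 𝔔 𝒩(𝔢)`,
`𝒜 = 𝒩(𝔞)`, `ℬ = 𝒩(𝔟)` — the level-`13` identity `𝔞 𝔟³ - 1728 x = 𝔠 𝔢²` pulled back along `x(u)`.
[folklore] -/
theorem seedM_klein (H : RD(a, b)) :
    (𝔔 * 𝒩(𝔢(K))) ^ 2 = 𝒩(𝔞(K)) * 𝒩(𝔟(K)) ^ 3 + C (1728 : K) * (𝔓) ^ 13 := by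
  obtain ⟨hKu, -⟩ := rdx_transcendental H
  have hQ := congr_arg (aeval (RatFunc.X : RatFunc K)) (pullback_thC H)
  obtain ⟨ha, hb, hc, he⟩ := natDegree_th (K := K)
  apply eq_of_aeval_ratFunc_X_eq
  generalize ((X : K[X]) ^ 2 - 13) = Dp at hKu hQ ⊢
  generalize (2 * b * (a - 3 * b)) = Kp at hKu hQ ⊢
  generalize (a ^ 2 - 6 * a * b + 13 * b ^ 2) = Qp at hQ ⊢
  simp only [map_pow, map_mul, map_add, aeval_C] at hQ ⊢
  rw [aeval_pullback_eq _ _ _ hKu, aeval_pullback_eq _ _ _ hKu, aeval_pullback_eq _ _ _ hKu, ha, hb, he]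
  rw [aeval_pullback_eq _ _ _ hKu, hc] at hQ
  have hx := th_identity_aeval (K := K) (⟪-Dp ^ 13⟫ / ⟪Kp⟫)
  rw [map_neg, map_pow] at hx hQ ⊢
  set M := ⟪Kp⟫
  set E := ⟪Dp⟫
  set xa := aeval (-E ^ 13 / M) 𝔞(K)
  set xb := aeval (-E ^ 13 / M) 𝔟(K)
  set xc := aeval (-E ^ 13 / M) 𝔠(K)
  set xe := aeval (-E ^ 13 / M) 𝔢(K)
  field_simp at hx
  simp only [map_ofNat]
  linear_combination (-M ^ 13) * hx + (-(M ^ 12 * xe ^ 2)) * hQ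

/-- `𝔤 - 1 = (𝒜 ℬ³)(u)/(1728 𝔓(u)¹³)`. [folklore] -/
theorem seedM_sub_one (H : RD(a, b)) :
    𝔤 - 1 = ⟪𝒩(𝔞(K)) * 𝒩(𝔟(K)) ^ 3⟫ / (algebraMap K (RatFunc K) 1728 * ⟪𝔓⟫ ^ 13) := by
  obtain ⟨-, -, -, -, -, -, -, hP0, -⟩ := rd_basic H
  have hPu : ⟪𝔓⟫ ≠ 0 := aeval_ratFunc_X_ne_zero hP0
  have h1728 : algebraMap K (RatFunc K) 1728 ≠ 0 := (_root_.map_ne_zero _).2 (by norm_num)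
  have hk := congr_arg (aeval (RatFunc.X : RatFunc K)) (seedM_klein H)
  rw [div_sub_one (mul_ne_zero h1728 (pow_ne_zero _ hPu))]
  congr 1
  generalize (𝒩(𝔞(K)) * 𝒩(𝔟(K)) ^ 3) = AB at hk ⊢
  generalize ((a ^ 2 - 6 * a * b + 13 * b ^ 2) * 𝒩(𝔢(K))) = T at hk ⊢
  generalize (((X : K[X]) ^ 2 - 13) * (2 * b * (a - 3 * b))) = Pp at hk ⊢
  rw [map_pow, map_add, map_mul, aeval_C, map_pow] at hk
  linear_combination hk

/-- **The order of the seed**: `v(𝔤) = 2 v(𝒯(u)) - 13 v(𝔓(u))`. [folklore] -/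
theorem ord_seedT (H : RD(a, b)) (P : PlaceOver K (RatFunc K)) :
    P.ord 𝔤 = 2 * P.ord ⟪𝔔 * 𝒩(𝔢(K))⟫ - 13 * P.ord ⟪𝔓⟫ := by
  obtain ⟨-, -, -, -, hK0, -, hQ0, hP0, -⟩ := rd_basic H
  obtain ⟨hKu, htr⟩ := rdx_transcendental H
  obtain ⟨-, -, -, he0⟩ := th_ne_zero (K := K)
  have hT0 : ⟪𝔔 * 𝒩(𝔢(K))⟫ ≠ 0 :=
    aeval_ratFunc_X_ne_zero (mul_ne_zero hQ0 (pullback_ne_zero he0 hK0 htr))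
  have hPu : ⟪𝔓⟫ ≠ 0 := aeval_ratFunc_X_ne_zero hP0
  obtain ⟨h1728, ho⟩ := seedI_const (K := K) P
  rw [P.ord_div (pow_ne_zero _ hT0) (mul_ne_zero h1728 (pow_ne_zero _ hPu)), P.ord_pow hT0,
    P.ord_mul_eq h1728 (pow_ne_zero _ hPu), P.ord_pow hPu, ho]
  push_cast; ring

/-- **The order of `𝔤 - 1`**: `v(𝔤 - 1) = v(𝒜(u)) + 3 v(ℬ(u)) - 13 v(𝔓(u))`. [folklore] -/
theorem ord_seedM_sub_one (H : RD(a, b)) (P : PlaceOver K (RatFunc K)) :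
    P.ord (𝔤 - 1) = P.ord ⟪𝒩(𝔞(K))⟫ + 3 * P.ord ⟪𝒩(𝔟(K))⟫ - 13 * P.ord ⟪𝔓⟫ := by
  obtain ⟨-, -, -, -, hK0, -, -, hP0, -⟩ := rd_basic H
  obtain ⟨hKu, htr⟩ := rdx_transcendental H
  obtain ⟨ha0, hb0, -, -⟩ := th_ne_zero (K := K)
  have hA0 : ⟪𝒩(𝔞(K))⟫ ≠ 0 := aeval_ratFunc_X_ne_zero (pullback_ne_zero ha0 hK0 htr)
  have hB0 : ⟪𝒩(𝔟(K))⟫ ≠ 0 := aeval_ratFunc_X_ne_zero (pullback_ne_zero hb0 hK0 htr)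
  have hPu : ⟪𝔓⟫ ≠ 0 := aeval_ratFunc_X_ne_zero hP0
  obtain ⟨h1728, ho⟩ := seedI_const (K := K) P
  rw [seedM_sub_one H, map_mul, map_pow,
    P.ord_div (mul_ne_zero hA0 (pow_ne_zero _ hB0)) (mul_ne_zero h1728 (pow_ne_zero _ hPu)),
    P.ord_mul_eq hA0 (pow_ne_zero _ hB0), P.ord_pow hB0, P.ord_mul_eq h1728 (pow_ne_zero _ hPu),
    P.ord_pow hPu, ho]
  push_cast; ring

/-- **Degrees and non-vanishing of the pulled-back forms**: `deg 𝒩(𝔢) = 156`, `deg 𝒩(𝔟) = 104`,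
`deg 𝒩(𝔞) = 52`, `deg 𝒯 = 182`, `deg 𝔓₁(r) = 26`. [folklore] -/
theorem seedM_natDegree (H : RD(a, b)) (r : K) :
    Polynomial.natDegree 𝒩(𝔢(K)) = 156 ∧ Polynomial.natDegree 𝒩(𝔟(K)) = 104 ∧
      Polynomial.natDegree 𝒩(𝔞(K)) = 52 ∧ Polynomial.natDegree (𝔔 * 𝒩(𝔢(K))) = 182 ∧
      Polynomial.natDegree 𝔓₁(r) = 26 ∧ 𝒩(𝔢(K)) ≠ 0 ∧ 𝒩(𝔟(K)) ≠ 0 ∧ 𝒩(𝔞(K)) ≠ 0 ∧ 𝔓₁(r) ≠ 0 := by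
  obtain ⟨hK, hN, hQ, -, hK0, hN0, hQ0, -⟩ := rd_basic H
  obtain ⟨hKu, htr⟩ := rdx_transcendental H
  obtain ⟨ha0, hb0, -, he0⟩ := th_ne_zero (K := K)
  obtain ⟨ha, hb, -, he⟩ := natDegree_th (K := K)
  have hlt : Polynomial.natDegree 𝔎 < Polynomial.natDegree 𝔑 := by rw [hK, hN]; norm_num
  have hE : Polynomial.natDegree 𝒩(𝔢(K)) = 156 := by
    rw [natDegree_pullback (A := 𝔑) (B := 𝔎) he0 hlt, he, hN]
  have hB : Polynomial.natDegree 𝒩(𝔟(K)) = 104 := by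
    rw [natDegree_pullback (A := 𝔑) (B := 𝔎) hb0 hlt, hb, hN]
  have hA : Polynomial.natDegree 𝒩(𝔞(K)) = 52 := by
    rw [natDegree_pullback (A := 𝔑) (B := 𝔎) ha0 hlt, ha, hN]
  have hE0 : 𝒩(𝔢(K)) ≠ 0 := pullback_ne_zero he0 hK0 htr
  have hB0 : 𝒩(𝔟(K)) ≠ 0 := pullback_ne_zero hb0 hK0 htr
  have hA0 : 𝒩(𝔞(K)) ≠ 0 := pullback_ne_zero ha0 hK0 htr
  have hP1 : Polynomial.natDegree 𝔓₁(r) = 26 := by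
    rw [natDegree_sub_eq_left_of_natDegree_lt, hN]
    rw [hN]
    exact lt_of_le_of_lt ((natDegree_C_mul_le _ _).trans hK.le) (by norm_num)
  refine ⟨hE, hB, hA, by rw [natDegree_mul hQ0 hE0, hQ, hE], hP1, hE0, hB0, hA0, fun h => ?_⟩
  rw [h, natDegree_zero] at hP1; exact absurd hP1 (by norm_num)

/-- `𝒩(X 𝔠) = 𝔑 𝔔²`. [folklore] -/
theorem pullback_X_thC (H : RD(a, b)) : 𝒩((X : K[X]) * 𝔠(K)) = 𝔑 * 𝔔 ^ 2 := by
  obtain ⟨-, -, -, -, hK0, -⟩ := rd_basic H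
  obtain ⟨-, -, hc0, -⟩ := th_ne_zero (K := K)
  rw [pullback_mul X_ne_zero hc0 hK0, pullback_X, pullback_thC H]

/-- **The Wronskian condition for the pull-back calculus along `x(u)`**: every irreducible factor of
`𝔑'𝔎 - 𝔑𝔎' = -26 (X² - 13)¹² 𝔔` divides `𝔎` or `𝒩(X 𝔠) = 𝔑 𝔔²` (the critical values of `x(u)` are
`0` and the roots of `𝔠`). [folklore] -/
theorem rd_wronskian_dvd (H : RD(a, b)) (ρ : K[X]) (hρ : Irreducible ρ)
    (h : ρ ∣ derivative 𝔑 * 𝔎 - 𝔑 * derivative 𝔎) : ρ ∣ 𝔎 ∨ ρ ∣ 𝒩((X : K[X]) * 𝔠(K)) := by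
  have h1 := H.2.2.1
  have h2 := H.2.2.2.1
  rw [wronskian_rdN_rdK h1 h2] at h
  rw [pullback_X_thC H]
  right
  have hp := hρ.prime
  rcases hp.dvd_or_dvd h with h | h
  · rcases hp.dvd_or_dvd h with h | h
    · rw [show (-26 : K[X]) = C (-26 : K) by rw [map_neg, map_ofNat]] at h
      exact (hρ.not_isUnit (isUnit_of_dvd_unit h (isUnit_C.mpr (by norm_num : (-26 : K) ≠ 0).isUnit))).elim
    · refine dvd_mul_of_dvd_left ((hp.dvd_of_dvd_pow h).trans ?_) _
      exact ⟨-(((X : K[X]) ^ 2 - 13) ^ 12), by ring⟩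
  · exact dvd_mul_of_dvd_right (h.trans (dvd_pow_self _ two_ne_zero)) _

/-- **The factor package of the composite seed.** With `𝔞 = (X - r₁)(X - r₂)`: the pole form `𝔓`, the
zero form `𝒯 = 𝔔 𝒩(𝔢)`, the triple-one form `ℬ = 𝒩(𝔟)` and the two simple-one forms `𝔓₁(r₁), 𝔓₁(r₂)`
are separable and pairwise coprime, and `𝒩(𝔞) = 𝔓₁(r₁) 𝔓₁(r₂)` — all from the `x`-level Bézout
identities through the pull-back calculus (`pullback_separable_of_isCoprime`, `isCoprime_pullback`).
[folklore] -/
theorem seedM_factors (H : RD(a, b)) {r₁ r₂ : K} (hr : 𝔞(K) = (X - C r₁) * (X - C r₂)) :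
    Polynomial.Separable 𝔓 ∧ Polynomial.Separable (𝔔 * 𝒩(𝔢(K))) ∧ Polynomial.Separable 𝒩(𝔟(K)) ∧
      Polynomial.Separable 𝔓₁(r₁) ∧ Polynomial.Separable 𝔓₁(r₂) ∧
      IsCoprime (𝔔 * 𝒩(𝔢(K))) 𝔓 ∧ IsCoprime 𝒩(𝔟(K)) 𝔓 ∧ IsCoprime 𝔓₁(r₁) 𝔓 ∧ IsCoprime 𝔓₁(r₂) 𝔓 ∧
      IsCoprime (𝔔 * 𝒩(𝔢(K))) 𝒩(𝔟(K)) ∧ IsCoprime (𝔔 * 𝒩(𝔢(K))) 𝔓₁(r₁) ∧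
      IsCoprime (𝔔 * 𝒩(𝔢(K))) 𝔓₁(r₂) ∧ IsCoprime 𝒩(𝔟(K)) 𝔓₁(r₁) ∧ IsCoprime 𝒩(𝔟(K)) 𝔓₁(r₂) ∧
      IsCoprime 𝔓₁(r₁) 𝔓₁(r₂) ∧ 𝒩(𝔞(K)) = 𝔓₁(r₁) * 𝔓₁(r₂) := by
  obtain ⟨ha, hb, h1, h2, hDb, hD3⟩ := id H
  obtain ⟨hK, hN, hQ, -, hK0, hN0, hQ0, hP0, hD0, hNK⟩ := rd_basic H
  obtain ⟨hKu, htr⟩ := rdx_transcendental H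
  obtain ⟨ha0, hb0, hc0, he0⟩ := th_ne_zero (K := K)
  obtain ⟨hab', hae, hbe, hac, hbc, hec⟩ := isCoprime_th (K := K)
  obtain ⟨haX, hbX, hcX, heX⟩ := isCoprime_th_X (K := K)
  obtain ⟨hsa, hsb, hse⟩ := separable_th (K := K)
  obtain ⟨hsP, -, -⟩ := separable_rdP ha hb h1 h2 hDb hD3
  obtain ⟨-, -, -, hsQ⟩ := separable_rd ha hb h1 h2 hDb hD3
  obtain ⟨hQb, hQ3, hQD⟩ := isCoprime_rdQ h1 hDb hD3
  -- the `x`-level product `π = 𝔟 𝔢 𝔞`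
  have hπs : (𝔟(K) * 𝔢(K) * 𝔞(K)).Separable :=
    (hsb.mul hse hbe).mul hsa ((hab'.symm).mul_left hae.symm)
  have hπS : IsCoprime (𝔟(K) * 𝔢(K) * 𝔞(K)) (X * 𝔠(K)) :=
    (((hbX.mul_left heX).mul_left haX)).mul_right ((hbc.mul_left hec).mul_left hac)
  have hπ0 : 𝔟(K) * 𝔢(K) * 𝔞(K) ≠ 0 := mul_ne_zero (mul_ne_zero hb0 he0) ha0
  have hbig0 : 𝒩(𝔟(K) * 𝔢(K) * 𝔞(K)) ≠ 0 := pullback_ne_zero hπ0 hK0 htr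
  have hbig : Polynomial.Separable 𝒩(𝔟(K) * 𝔢(K) * 𝔞(K)) :=
    pullback_separable_of_isCoprime hπs hπS hNK (rd_wronskian_dvd H) hbig0
  -- `𝒩(π) = ℬ ℰ (𝔓₁(r₁) 𝔓₁(r₂))`
  have hl1 : (X - C r₁ : K[X]) ≠ 0 := X_sub_C_ne_zero r₁
  have hl2 : (X - C r₂ : K[X]) ≠ 0 := X_sub_C_ne_zero r₂
  have hAeq : 𝒩(𝔞(K)) = 𝔓₁(r₁) * 𝔓₁(r₂) := by
    rw [hr, pullback_mul hl1 hl2 hK0, pullback_X_sub_C, pullback_X_sub_C]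
  have hsplit : 𝒩(𝔟(K) * 𝔢(K) * 𝔞(K)) = 𝒩(𝔟(K)) * 𝒩(𝔢(K)) * (𝔓₁(r₁) * 𝔓₁(r₂)) := by
    rw [pullback_mul (mul_ne_zero hb0 he0) ha0 hK0, pullback_mul hb0 he0 hK0, hAeq]
  rw [hsplit] at hbig hbig0
  obtain ⟨hBE, hPP, hBEPP⟩ := separable_mul_iff'.mp hbig
  obtain ⟨hsB, hsE, hcBE⟩ := separable_mul_iff'.mp hBE
  obtain ⟨hs1, hs2, hc12⟩ := separable_mul_iff'.mp hPP
  have hB1 : IsCoprime 𝒩(𝔟(K)) 𝔓₁(r₁) := hBEPP.of_mul_left_left.of_mul_right_left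
  have hB2 : IsCoprime 𝒩(𝔟(K)) 𝔓₁(r₂) := hBEPP.of_mul_left_left.of_mul_right_right
  have hE1 : IsCoprime 𝒩(𝔢(K)) 𝔓₁(r₁) := hBEPP.of_mul_left_right.of_mul_right_left
  have hE2 : IsCoprime 𝒩(𝔢(K)) 𝔓₁(r₂) := hBEPP.of_mul_left_right.of_mul_right_right
  -- `𝔔` against the pulled-back forms: `𝔔² = 𝒩(𝔠)` and `𝔠` is prime to `π`
  have hcπ : IsCoprime 𝔠(K) (𝔟(K) * 𝔢(K) * 𝔞(K)) := (hbc.symm.mul_right hec.symm).mul_right hac.symm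
  have hQbig : IsCoprime 𝔔 (𝒩(𝔟(K)) * 𝒩(𝔢(K)) * (𝔓₁(r₁) * 𝔓₁(r₂))) := by
    have h := isCoprime_pullback hcπ hNK hc0 (pullback_ne_zero hc0 hK0 htr)
    rw [pullback_thC H, hsplit] at h
    exact (IsCoprime.pow_left_iff two_pos).mp h
  have hQB : IsCoprime 𝔔 𝒩(𝔟(K)) := hQbig.of_mul_right_left.of_mul_right_left
  have hQE : IsCoprime 𝔔 𝒩(𝔢(K)) := hQbig.of_mul_right_left.of_mul_right_right
  have hQ1 : IsCoprime 𝔔 𝔓₁(r₁) := hQbig.of_mul_right_right.of_mul_right_left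
  have hQ2 : IsCoprime 𝔔 𝔓₁(r₂) := hQbig.of_mul_right_right.of_mul_right_right
  -- the pole form against the pulled-back forms
  have hπ0' : (𝔟(K) * 𝔢(K) * 𝔞(K)).eval 0 ≠ 0 := by
    obtain ⟨hae', hbe', -, hee'⟩ := th_eval (K := K)
    rw [eval_mul, eval_mul, hae', hbe', hee']; norm_num
  have hbigK : IsCoprime (𝒩(𝔟(K)) * 𝒩(𝔢(K)) * (𝔓₁(r₁) * 𝔓₁(r₂))) 𝔎 := by
    rw [← hsplit]; exact isCoprime_pullback_right hπ0 hNK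
  have hbigD : IsCoprime (𝒩(𝔟(K)) * 𝒩(𝔢(K)) * (𝔓₁(r₁) * 𝔓₁(r₂))) ((X : K[X]) ^ 2 - 13) := by
    have h := isCoprime_pullback_left hπ0' hNK
    rw [hsplit] at h
    exact h.of_isCoprime_of_dvd_right ⟨-(((X : K[X]) ^ 2 - 13) ^ 12), by ring⟩
  have hbigP : IsCoprime (𝒩(𝔟(K)) * 𝒩(𝔢(K)) * (𝔓₁(r₁) * 𝔓₁(r₂))) 𝔓 := hbigD.mul_right hbigK
  have hBP : IsCoprime 𝒩(𝔟(K)) 𝔓 := hbigP.of_mul_left_left.of_mul_left_left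
  have hEP : IsCoprime 𝒩(𝔢(K)) 𝔓 := hbigP.of_mul_left_left.of_mul_left_right
  have h1P : IsCoprime 𝔓₁(r₁) 𝔓 := hbigP.of_mul_left_right.of_mul_left_left
  have h2P : IsCoprime 𝔓₁(r₂) 𝔓 := hbigP.of_mul_left_right.of_mul_left_right
  have hQK : IsCoprime 𝔔 𝔎 := by
    have h2b : IsCoprime 𝔔 (2 * b) := by
      rw [show (2 : K[X]) = C (2 : K) by rw [map_ofNat], isCoprime_C_mul_right_iff two_ne_zero]; exact hQb
    exact h2b.mul_right hQ3
  have hQP : IsCoprime 𝔔 𝔓 := hQD.mul_right hQK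
  -- the zero form `𝒯 = 𝔔 ℰ`
  refine ⟨hsP, hsQ.mul hsE hQE, hsB, hs1, hs2, hQP.mul_left hEP, hBP, h1P, h2P,
    hQB.mul_left hcBE.symm, hQ1.mul_left hE1, hQ2.mul_left hE2, hB1, hB2, hc12, hAeq⟩

omit [CharZero K] in
/-- `a + b + c + d = 0` for `a, b, c, d ≥ 0` forces all to vanish. [folklore] -/
private theorem aux_zero4 {a b c d : ℤ} (ha : 0 ≤ a) (hb : 0 ≤ b) (hc : 0 ≤ c) (hd : 0 ≤ d)
    (h : a + b + c + d = 0) : a = 0 ∧ b = 0 ∧ c = 0 ∧ d = 0 := by omega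

/-- **The five kinds of places of the line for the composite seed.** At every place `P` of `K(u)` (with
`𝔞 = (X - r₁)(X - r₂)`, `𝔥 = 𝔓₁(r₁) 𝔓₁(r₂)²`) one of: (poles: `u = ∞` or `𝔓(u) = 0`) `v(𝔤 - 1) = v(𝔤) = -13`
and `3 ∣ v(𝔥)` (`v(𝔥) = -78` or `0`), with `v(π₀(𝔤)) = deg π₀ · v(𝔤)`; (zeros: `𝒯(u) = 0`) `v(𝔤) = 2`,
`v(𝔤 - 1) = 0`, `v(𝔥) = 0`; (ones) `v(𝔤) = 0` and either `v(𝔤 - 1) = 3`, `v(𝔥) = 0` (`ℬ(u) = 0`) or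
`v(𝔤 - 1) = 1`, `v(𝔥) ∈ {1, 2}` (`𝔓₁(rₘ)(u) = 0`); (generic) `u ∈ 𝒪_P`, `𝔎(u), 𝔑(u), 𝔓(u)` units,
`v(𝔤) = v(𝔤 - 1) = v(𝔥) = 0`. [folklore] -/
theorem seedM_cases (H : RD(a, b)) {r₁ r₂ : K} (hr : 𝔞(K) = (X - C r₁) * (X - C r₂))
    {g h : RatFunc K} (hgdef : g = 𝔤) (hhdef : h = 𝔥(r₁, r₂)) (P : PlaceOver K (RatFunc K)) :
    (P.ord g < 0 ∧ P.ord (g - 1) = P.ord g ∧ P.ord g = -13 ∧ (3 : ℤ) ∣ P.ord h ∧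
        ∀ π₀ : K[X], π₀ ≠ 0 → P.ord (aeval g π₀) = π₀.natDegree * P.ord g) ∨
      (P.ord g = 2 ∧ P.ord (g - 1) = 0 ∧ P.ord h = 0 ∧
        ∀ π₀ : K[X], π₀.eval 0 ≠ 0 → P.ord (aeval g π₀) = 0) ∨
      (P.ord g = 0 ∧ ((P.ord (g - 1) = 3 ∧ (3 : ℤ) ∣ P.ord h) ∨
          ((3 : ℤ) * P.ord (g - 1) = 3 ∧ IsCoprime (P.ord h) 3)) ∧
        ∀ π₀ : K[X], π₀.eval 1 ≠ 0 → P.ord (aeval g π₀) = 0) ∨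
      ((RatFunc.X : RatFunc K) ∈ P.toValuationSubring ∧ P.ord ⟪𝔎⟫ = 0 ∧ P.ord ⟪𝔑⟫ = 0 ∧ P.ord ⟪𝔓⟫ = 0 ∧
        P.ord g = 0 ∧ P.ord (g - 1) = 0 ∧ P.ord h = 0) := by
  subst hgdef hhdef
  have hut := RatFunc.transcendental_X (K := K)
  have hu1 := finrank_adjoin_ratFunc_X (K := K)
  obtain ⟨hK, hN, hQ, hPdeg, hK0, hN0, hQ0, hP0, hD0, -⟩ := rd_basic H
  obtain ⟨hEdeg, hBdeg, -, hTdeg, hP1deg, hE0, hB0, hA0, hP10⟩ := seedM_natDegree H r₁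
  obtain ⟨-, -, -, -, hP2deg, -, -, -, hP20⟩ := seedM_natDegree H r₂
  obtain ⟨hsP, hsT, hsB, hs1, hs2, hTP, hBP, h1P, h2P, hTB, hT1, hT2, hB1, hB2, h12, hAeq⟩ :=
    seedM_factors H hr
  have hT0 : 𝔔 * 𝒩(𝔢(K)) ≠ 0 := mul_ne_zero hQ0 hE0
  have hh0 : 𝔓₁(r₁) * 𝔓₁(r₂) ^ 2 ≠ 0 := mul_ne_zero hP10 (pow_ne_zero _ hP20)
  have hhdeg : Polynomial.natDegree (𝔓₁(r₁) * 𝔓₁(r₂) ^ 2) = 78 := by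
    rw [natDegree_mul hP10 (pow_ne_zero _ hP20), natDegree_pow, hP1deg, hP2deg]
  have hTu : ⟪𝔔 * 𝒩(𝔢(K))⟫ ≠ 0 := aeval_ratFunc_X_ne_zero hT0
  have hPu : ⟪𝔓⟫ ≠ 0 := aeval_ratFunc_X_ne_zero hP0
  have hBu : ⟪𝒩(𝔟(K))⟫ ≠ 0 := aeval_ratFunc_X_ne_zero hB0
  have h1u : ⟪𝔓₁(r₁)⟫ ≠ 0 := aeval_ratFunc_X_ne_zero hP10
  have h2u : ⟪𝔓₁(r₂)⟫ ≠ 0 := aeval_ratFunc_X_ne_zero hP20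
  have hKu : ⟪𝔎⟫ ≠ 0 := aeval_ratFunc_X_ne_zero hK0
  have hDu : ⟪(X : K[X]) ^ 2 - 13⟫ ≠ 0 := aeval_ratFunc_X_ne_zero hD0
  have hordg := ord_seedT H P
  have hordg1 := ord_seedM_sub_one H P
  have hordA : P.ord ⟪𝒩(𝔞(K))⟫ = P.ord ⟪𝔓₁(r₁)⟫ + P.ord ⟪𝔓₁(r₂)⟫ := by
    rw [hAeq, map_mul, P.ord_mul_eq h1u h2u]
  have hordh : P.ord 𝔥(r₁, r₂) = P.ord ⟪𝔓₁(r₁)⟫ + 2 * P.ord ⟪𝔓₁(r₂)⟫ := by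
    rw [map_mul, map_pow, P.ord_mul_eq h1u (pow_ne_zero _ h2u), P.ord_pow h2u]; push_cast; ring
  have hordP : P.ord ⟪𝔓⟫ = P.ord ⟪(X : K[X]) ^ 2 - 13⟫ + P.ord ⟪𝔎⟫ := by
    rw [map_mul, P.ord_mul_eq hDu hKu]
  have hordN : P.ord ⟪𝔑⟫ = 13 * P.ord ⟪(X : K[X]) ^ 2 - 13⟫ := by
    rw [map_neg, P.ord_neg, map_pow, P.ord_pow hDu]; push_cast; ring
  rcases lt_or_ge (P.ord (RatFunc.X : RatFunc K)) 0 with hneg | hge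
  · -- (∞): the place at infinity, a pole of order `13`
    left
    have hvm1 : P.ord (RatFunc.X : RatFunc K) = -1 := P.ord_eq_neg_one_of_finrank_eq_one hut hu1 hneg
    have hoT : P.ord ⟪𝔔 * 𝒩(𝔢(K))⟫ = -182 := by
      rw [(P.ord_aeval_of_ord_neg hneg hT0).2, hTdeg, hvm1]; norm_num
    have hoP : P.ord ⟪𝔓⟫ = -27 := by rw [(P.ord_aeval_of_ord_neg hneg hP0).2, hPdeg, hvm1]; norm_num
    have hoB : P.ord ⟪𝒩(𝔟(K))⟫ = -104 := by
      rw [(P.ord_aeval_of_ord_neg hneg hB0).2, hBdeg, hvm1]; norm_num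
    have ho1 : P.ord ⟪𝔓₁(r₁)⟫ = -26 := by
      rw [(P.ord_aeval_of_ord_neg hneg hP10).2, hP1deg, hvm1]; norm_num
    have ho2 : P.ord ⟪𝔓₁(r₂)⟫ = -26 := by
      rw [(P.ord_aeval_of_ord_neg hneg hP20).2, hP2deg, hvm1]; norm_num
    have hoh : P.ord 𝔥(r₁, r₂) = -78 := by rw [hordh, ho1, ho2]; norm_num
    have hg : P.ord 𝔤 = -13 := by rw [hordg, hoT, hoP]; norm_num
    refine ⟨by rw [hg]; norm_num, by rw [hordg1, hordA, ho1, ho2, hoB, hoP, hg]; norm_num, hg,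
      by rw [hoh]; norm_num, fun π₀ hπ => ?_⟩
    exact (P.ord_aeval_of_ord_neg (by rw [hg]; norm_num) hπ).2
  · -- `u ∈ 𝒪_P`
    have hvO : (RatFunc.X : RatFunc K) ∈ P.toValuationSubring :=
      (P.mem_toValuationSubring_iff_ord_nonneg RatFunc.X_ne_zero).2 hge
    have hnnT : 0 ≤ P.ord ⟪𝔔 * 𝒩(𝔢(K))⟫ := P.ord_nonneg_of_mem (P.aeval_mem hvO _)
    have hnnP : 0 ≤ P.ord ⟪𝔓⟫ := P.ord_nonneg_of_mem (P.aeval_mem hvO _)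
    have hnnB : 0 ≤ P.ord ⟪𝒩(𝔟(K))⟫ := P.ord_nonneg_of_mem (P.aeval_mem hvO _)
    have hnn1 : 0 ≤ P.ord ⟪𝔓₁(r₁)⟫ := P.ord_nonneg_of_mem (P.aeval_mem hvO _)
    have hnn2 : 0 ≤ P.ord ⟪𝔓₁(r₂)⟫ := P.ord_nonneg_of_mem (P.aeval_mem hvO _)
    have hnnD : 0 ≤ P.ord ⟪(X : K[X]) ^ 2 - 13⟫ := P.ord_nonneg_of_mem (P.aeval_mem hvO _)
    have hnnK : 0 ≤ P.ord ⟪𝔎⟫ := P.ord_nonneg_of_mem (P.aeval_mem hvO _)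
    -- at most one of the five coprime forms vanishes at `P`
    have hexTP := P.not_and_ord_aeval_pos_of_isCoprime hvO hTP hTu hPu
    have hexBP := P.not_and_ord_aeval_pos_of_isCoprime hvO hBP hBu hPu
    have hex1P := P.not_and_ord_aeval_pos_of_isCoprime hvO h1P h1u hPu
    have hex2P := P.not_and_ord_aeval_pos_of_isCoprime hvO h2P h2u hPu
    have hexTB := P.not_and_ord_aeval_pos_of_isCoprime hvO hTB hTu hBu
    have hexT1 := P.not_and_ord_aeval_pos_of_isCoprime hvO hT1 hTu h1u
    have hexT2 := P.not_and_ord_aeval_pos_of_isCoprime hvO hT2 hTu h2u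
    have hexB1 := P.not_and_ord_aeval_pos_of_isCoprime hvO hB1 hBu h1u
    have hexB2 := P.not_and_ord_aeval_pos_of_isCoprime hvO hB2 hBu h2u
    have hex12 := P.not_and_ord_aeval_pos_of_isCoprime hvO h12 h1u h2u
    rcases hnnP.lt_or_eq with hPpos | hPz
    · -- poles at finite distance: `𝔓(u) = 0`
      left
      have hP1 : P.ord ⟪𝔓⟫ = 1 := P.ord_aeval_eq_one_of_separable_of_finrank_eq_one hut hu1 hsP hPpos
      have hTz : P.ord ⟪𝔔 * 𝒩(𝔢(K))⟫ = 0 := by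
        rcases hnnT.lt_or_eq with h | h
        · exact (hexTP ⟨h, hPpos⟩).elim
        · exact h.symm
      have hBz : P.ord ⟪𝒩(𝔟(K))⟫ = 0 := by
        rcases hnnB.lt_or_eq with h | h
        · exact (hexBP ⟨h, hPpos⟩).elim
        · exact h.symm
      have h1z : P.ord ⟪𝔓₁(r₁)⟫ = 0 := by
        rcases hnn1.lt_or_eq with h | h
        · exact (hex1P ⟨h, hPpos⟩).elim
        · exact h.symm
      have h2z : P.ord ⟪𝔓₁(r₂)⟫ = 0 := by
        rcases hnn2.lt_or_eq with h | h
        · exact (hex2P ⟨h, hPpos⟩).elim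
        · exact h.symm
      have hg : P.ord 𝔤 = -13 := by rw [hordg, hTz, hP1]; norm_num
      refine ⟨by rw [hg]; norm_num, by rw [hordg1, hordA, h1z, h2z, hBz, hP1, hg]; norm_num, hg,
        by rw [hordh, h1z, h2z]; norm_num, fun π₀ hπ => ?_⟩
      exact (P.ord_aeval_of_ord_neg (by rw [hg]; norm_num) hπ).2
    -- `𝔓(u)` a unit: `𝔎(u)`, `𝔑(u)` units
    have hPz' : P.ord ⟪𝔓⟫ = 0 := hPz.symm
    have hKz : P.ord ⟪𝔎⟫ = 0 := by omega
    have hNz : P.ord ⟪𝔑⟫ = 0 := by rw [hordN]; omega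
    rcases hnnT.lt_or_eq with hTpos | hTz
    · -- zeros: `𝒯(u) = 0`, the points over `j = 1728`
      right; left
      have hT1 : P.ord ⟪𝔔 * 𝒩(𝔢(K))⟫ = 1 := P.ord_aeval_eq_one_of_separable_of_finrank_eq_one hut hu1 hsT hTpos
      have hBz : P.ord ⟪𝒩(𝔟(K))⟫ = 0 := by
        rcases hnnB.lt_or_eq with h | h
        · exact (hexTB ⟨hTpos, h⟩).elim
        · exact h.symm
      have h1z : P.ord ⟪𝔓₁(r₁)⟫ = 0 := by
        rcases hnn1.lt_or_eq with h | h
        · exact (hexT1 ⟨hTpos, h⟩).elim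
        · exact h.symm
      have h2z : P.ord ⟪𝔓₁(r₂)⟫ = 0 := by
        rcases hnn2.lt_or_eq with h | h
        · exact (hexT2 ⟨hTpos, h⟩).elim
        · exact h.symm
      have hg : P.ord 𝔤 = 2 := by rw [hordg, hT1, hPz']; norm_num
      refine ⟨hg, by rw [hordg1, hordA, h1z, h2z, hBz, hPz']; norm_num, by rw [hordh, h1z, h2z]; norm_num,
        fun π₀ h0 => ?_⟩
      exact (P.ord_aeval_eq_zero_of_eval_ne_zero (by rw [hg]; norm_num) h0).2
    have hTz' : P.ord ⟪𝔔 * 𝒩(𝔢(K))⟫ = 0 := hTz.symm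
    have hg : P.ord 𝔤 = 0 := by rw [hordg, hTz', hPz']; norm_num
    rcases hnnB.lt_or_eq with hBpos | hBz
    · -- triple ones: `ℬ(u) = 0`
      right; right; left
      have hB1' : P.ord ⟪𝒩(𝔟(K))⟫ = 1 := P.ord_aeval_eq_one_of_separable_of_finrank_eq_one hut hu1 hsB hBpos
      have h1z : P.ord ⟪𝔓₁(r₁)⟫ = 0 := by
        rcases hnn1.lt_or_eq with h | h
        · exact (hexB1 ⟨hBpos, h⟩).elim
        · exact h.symm
      have h2z : P.ord ⟪𝔓₁(r₂)⟫ = 0 := by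
        rcases hnn2.lt_or_eq with h | h
        · exact (hexB2 ⟨hBpos, h⟩).elim
        · exact h.symm
      have hg1 : P.ord (𝔤 - 1) = 3 := by rw [hordg1, hordA, h1z, h2z, hB1', hPz']; norm_num
      refine ⟨hg, Or.inl ⟨hg1, by rw [hordh, h1z, h2z]; norm_num⟩, fun π₀ h1 => ?_⟩
      exact ord_aeval_eq_zero_of_ord_sub_one_pos P (by rw [hg1]; norm_num) h1
    have hBz' : P.ord ⟪𝒩(𝔟(K))⟫ = 0 := hBz.symm
    rcases hnn1.lt_or_eq with h1pos | h1z
    · -- simple ones of the first kind: `𝔓₁(r₁)(u) = 0`, `v(𝔥) = 1`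
      right; right; left
      have h11 : P.ord ⟪𝔓₁(r₁)⟫ = 1 := P.ord_aeval_eq_one_of_separable_of_finrank_eq_one hut hu1 hs1 h1pos
      have h2z : P.ord ⟪𝔓₁(r₂)⟫ = 0 := by
        rcases hnn2.lt_or_eq with h | h
        · exact (hex12 ⟨h1pos, h⟩).elim
        · exact h.symm
      have hg1 : P.ord (𝔤 - 1) = 1 := by rw [hordg1, hordA, h11, h2z, hBz', hPz']; norm_num
      refine ⟨hg, Or.inr ⟨by rw [hg1]; norm_num, ?_⟩, fun π₀ h1 => ?_⟩
      · rw [hordh, h11, h2z]; norm_num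
      · exact ord_aeval_eq_zero_of_ord_sub_one_pos P (by rw [hg1]; norm_num) h1
    have h1z' : P.ord ⟪𝔓₁(r₁)⟫ = 0 := h1z.symm
    rcases hnn2.lt_or_eq with h2pos | h2z
    · -- simple ones of the second kind: `𝔓₁(r₂)(u) = 0`, `v(𝔥) = 2`
      right; right; left
      have h21 : P.ord ⟪𝔓₁(r₂)⟫ = 1 := P.ord_aeval_eq_one_of_separable_of_finrank_eq_one hut hu1 hs2 h2pos
      have hg1 : P.ord (𝔤 - 1) = 1 := by rw [hordg1, hordA, h1z', h21, hBz', hPz']; norm_num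
      refine ⟨hg, Or.inr ⟨by rw [hg1]; norm_num, ?_⟩, fun π₀ h1 => ?_⟩
      · rw [hordh, h1z', h21]; norm_num
      · exact ord_aeval_eq_zero_of_ord_sub_one_pos P (by rw [hg1]; norm_num) h1
    · -- generic
      right; right; right
      have h2z' : P.ord ⟪𝔓₁(r₂)⟫ = 0 := h2z.symm
      exact ⟨hvO, hKz, hNz, hPz', hg, by rw [hordg1, hordA, h1z', h2z', hBz', hPz']; norm_num,
        by rw [hordh, h1z', h2z']; norm_num⟩

/-- **The seed is non-zero, has a pole at infinity, hence is transcendental over `K` and is not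
annihilated by a non-zero polynomial.** [cite: Stichtenoth2009, Prop. 1.1.5(c), Cor. 1.1.20] -/
theorem seedM_transcendental (H : RD(a, b)) :
    𝔤 ≠ 0 ∧ Transcendental K 𝔤 ∧ ∀ π₀ : K[X], π₀ ≠ 0 → aeval 𝔤 π₀ ≠ 0 := by
  have hut := RatFunc.transcendental_X (K := K)
  have hu1 := finrank_adjoin_ratFunc_X (K := K)
  obtain ⟨-, -, -, hPdeg, -, -, hQ0, hP0, -⟩ := rd_basic H
  obtain ⟨-, -, -, hTdeg, -, hE0, -⟩ := seedM_natDegree H 0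
  have hT0 : 𝔔 * 𝒩(𝔢(K)) ≠ 0 := mul_ne_zero hQ0 hE0
  have hTu : ⟪𝔔 * 𝒩(𝔢(K))⟫ ≠ 0 := aeval_ratFunc_X_ne_zero hT0
  have hPu : ⟪𝔓⟫ ≠ 0 := aeval_ratFunc_X_ne_zero hP0
  have h1728 : algebraMap K (RatFunc K) 1728 ≠ 0 := (_root_.map_ne_zero _).2 (by norm_num)
  have hg0 : 𝔤 ≠ 0 := div_ne_zero (pow_ne_zero _ hTu) (mul_ne_zero h1728 (pow_ne_zero _ hPu))
  obtain ⟨P, hP⟩ := exists_ord_pos_of_transcendental (K := K) (F := RatFunc K)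
    (fun h => hut (IsAlgebraic.inv_iff.1 h))
  rw [P.ord_inv RatFunc.X_ne_zero] at hP
  have hneg : P.ord (RatFunc.X : RatFunc K) < 0 := by omega
  have hvm1 : P.ord (RatFunc.X : RatFunc K) = -1 := P.ord_eq_neg_one_of_finrank_eq_one hut hu1 hneg
  have hoT : P.ord ⟪𝔔 * 𝒩(𝔢(K))⟫ = -182 := by
    rw [(P.ord_aeval_of_ord_neg hneg hT0).2, hTdeg, hvm1]; norm_num
  have hoP : P.ord ⟪𝔓⟫ = -27 := by rw [(P.ord_aeval_of_ord_neg hneg hP0).2, hPdeg, hvm1]; norm_num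
  have hpole : P.ord 𝔤 < 0 := by rw [ord_seedT H, hoT, hoP]; norm_num
  have htr : Transcendental K 𝔤 := by
    intro halg
    have hmem := IsAlgFunctionField.mem_valuationSubring_of_isAlgebraic P.toValuationSubring
      P.algebraMap_mem halg
    have := (P.mem_toValuationSubring_iff_ord_nonneg hg0).1 hmem
    omega
  exact ⟨hg0, htr, fun π₀ hπ h => htr ⟨π₀, hπ, h⟩⟩

/-- **The seed is the composite `𝔤ₓ ∘ x`** of the level-`13` seed `𝔤ₓ = 𝔠 𝔢²/(-1728 x) = 1 - j₁₃/1728`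
with `x(u) = 𝔑(u)/𝔎(u)`. [folklore] -/
theorem seedM_eq_comp (H : RD(a, b)) :
    𝔤 = aeval (⟪𝔑⟫ / ⟪𝔎⟫) (𝔠(K) * 𝔢(K) ^ 2) / aeval (⟪𝔑⟫ / ⟪𝔎⟫) (C (-1728 : K) * X) := by
  obtain ⟨-, -, -, -, hK0, hN0, -, -, hD0, -⟩ := rd_basic H
  obtain ⟨hKu, -⟩ := rdx_transcendental H
  have hDu : ⟪(X : K[X]) ^ 2 - 13⟫ ≠ 0 := aeval_ratFunc_X_ne_zero hD0
  have hQ := congr_arg (aeval (RatFunc.X : RatFunc K)) (pullback_thC H)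
  obtain ⟨-, -, hc, he⟩ := natDegree_th (K := K)
  have h1728 : algebraMap K (RatFunc K) 1728 ≠ 0 := (_root_.map_ne_zero _).2 (by norm_num)
  have h1728' : algebraMap K (RatFunc K) (-1728) ≠ 0 := (_root_.map_ne_zero _).2 (by norm_num)
  generalize ((X : K[X]) ^ 2 - 13) = Dp at hKu hQ hDu ⊢
  generalize (2 * b * (a - 3 * b)) = Kp at hKu hQ ⊢
  generalize (a ^ 2 - 6 * a * b + 13 * b ^ 2) = Qp at hQ ⊢
  simp only [map_pow, map_mul, map_neg, aeval_C, aeval_X] at hQ ⊢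
  rw [aeval_pullback_eq _ _ _ hKu, he]
  rw [aeval_pullback_eq _ _ _ hKu, hc] at hQ
  rw [map_neg, map_pow] at hQ ⊢
  set M := ⟪Kp⟫
  set E := ⟪Dp⟫
  set xc := aeval (-E ^ 13 / M) 𝔠(K)
  set xe := aeval (-E ^ 13 / M) 𝔢(K)
  have hE13 : E ^ 13 ≠ 0 := pow_ne_zero _ hDu
  rw [mul_pow, ← hQ]
  field_simp

/-- **The other closed points are unramified for the composite seed.** For `π₀` monic irreducible,
`π₀ ∉ {X, X - 1}`, at every zero `P` of `π₀(𝔤)` on the line: `v_P(π₀(𝔤)) = 1` and `𝔥` is a unit. The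
place is generic (`seedM_cases`); there `π₀(𝔤) · (unit) = M(u)` for the DOUBLE pull-back
`M = 𝒩(Ñ)`, `Ñ` the pull-back of `π₀` along the level-`13` seed `𝔠 𝔢²/(-1728 x)` (separable by the even
companion's `pullback_separable`: Wronskian `-1728 · 13 𝔢 𝔟²`, `A₀ - B₀ = 𝔞 𝔟³`), and `M` is separable by
`pullback_separable_of_isCoprime` (`Ñ` is prime to `X 𝔠`, the critical values of `x(u)`). [folklore] -/
theorem seedM_elsewhere (H : RD(a, b)) {r₁ r₂ : K} (hr : 𝔞(K) = (X - C r₁) * (X - C r₂))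
    {g h : RatFunc K} (hgdef : g = 𝔤) (hhdef : h = 𝔥(r₁, r₂))
    {π₀ : K[X]} (hπi : Irreducible π₀) (hπm : π₀.Monic) (hπX : π₀ ≠ X) (hπX1 : π₀ ≠ X - 1)
    (P : PlaceOver K (RatFunc K)) (hP : 0 < P.ord (aeval g π₀)) :
    P.ord (aeval g π₀) = 1 ∧ P.ord h = 0 := by
  have hut := RatFunc.transcendental_X (K := K)
  have hu1 := finrank_adjoin_ratFunc_X (K := K)
  have h0 : π₀.eval 0 ≠ 0 := fun h0 => hπX (by
    have h := PlaceOver.eq_X_sub_C_of_irreducible_of_eval_eq_zero hπi hπm h0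
    rwa [map_zero, sub_zero] at h)
  have h1 : π₀.eval 1 ≠ 0 := fun h1 => hπX1 (by
    have h := PlaceOver.eq_X_sub_C_of_irreducible_of_eval_eq_zero hπi hπm h1
    rwa [map_one] at h)
  rcases seedM_cases H hr hgdef hhdef P with
      ⟨hlt, -, -, -, hall⟩ | ⟨-, -, -, hall⟩ | ⟨-, -, hall⟩ | ⟨hvO, hKz, hNz, -, -, -, hhz⟩
  · rw [hall π₀ hπi.ne_zero] at hP
    have h5 : (π₀.natDegree : ℤ) * P.ord g ≤ 0 := mul_nonpos_of_nonneg_of_nonpos (by positivity) hlt.le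
    exact absurd hP (not_lt.2 h5)
  · rw [hall π₀ h0] at hP; exact (lt_irrefl _ hP).elim
  · rw [hall π₀ h1] at hP; exact (lt_irrefl _ hP).elim
  refine ⟨?_, hhz⟩
  obtain ⟨hK, hN, hQ, hPdeg, hK0, hN0, hQ0, hP0, hD0, hNK⟩ := rd_basic H
  obtain ⟨hKu, htr⟩ := rdx_transcendental H
  obtain ⟨-, hb0, hc0, he0⟩ := th_ne_zero (K := K)
  obtain ⟨-, hbdeg, hcdeg, hedeg⟩ := natDegree_th (K := K)
  obtain ⟨-, hbX, hcX, heX⟩ := isCoprime_th_X (K := K)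
  -- the `x`-level pull-back `Ñ` of `π₀` along `A₀/B₀ = 𝔠 𝔢²/(-1728 x)`
  set A₀ : K[X] := 𝔠(K) * 𝔢(K) ^ 2 with hA₀
  set B₀ : K[X] := C (-1728 : K) * X with hB₀
  have hcop0 : IsCoprime A₀ B₀ := by
    rw [hA₀, hB₀, isCoprime_C_mul_right_iff (by norm_num)]
    exact hcX.mul_left heX.pow_left
  have hW0 : ∀ ρ : K[X], Irreducible ρ → ρ ∣ derivative A₀ * B₀ - A₀ * derivative B₀ →
      ρ ∣ A₀ ∨ ρ ∣ B₀ ∨ ρ ∣ A₀ - B₀ := by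
    intro ρ hρ hdvd
    rw [hA₀, hB₀, wronskian_th'] at hdvd
    have hp := hρ.prime
    rcases hp.dvd_or_dvd hdvd with h | h
    · exact (hρ.not_isUnit (isUnit_of_dvd_unit h (isUnit_C.mpr (by norm_num : (-1728 : K) ≠ 0).isUnit))).elim
    rcases hp.dvd_or_dvd h with h | h
    · rcases hp.dvd_or_dvd h with h | h
      · rw [show (13 : K[X]) = C (13 : K) by rw [map_ofNat]] at h
        exact (hρ.not_isUnit (isUnit_of_dvd_unit h (isUnit_C.mpr (by norm_num : (13 : K) ≠ 0).isUnit))).elim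
      · left; rw [hA₀]; exact dvd_mul_of_dvd_right (h.trans (dvd_pow_self _ two_ne_zero)) _
    · right; right
      have e : A₀ - B₀ = 𝔞(K) * 𝔟(K) ^ 3 := by
        rw [hA₀, hB₀, ← thA_mul_thB_pow, map_neg, map_ofNat]; ring
      rw [e]
      exact dvd_mul_of_dvd_right ((hp.dvd_of_dvd_pow h).trans (dvd_pow_self _ three_ne_zero)) _
  have hdegA₀ : A₀.natDegree = 14 := by
    rw [hA₀, natDegree_mul hc0 (pow_ne_zero _ he0), natDegree_pow, hcdeg, hedeg]
  have hdegB₀ : B₀.natDegree = 1 := by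
    rw [hB₀, natDegree_C_mul (by norm_num), natDegree_X]
  set Ñ : K[X] := ∑ j ∈ Finset.range (π₀.natDegree + 1),
    C (π₀.coeff j) * A₀ ^ j * B₀ ^ (π₀.natDegree - j) with hÑ
  have hÑdeg : Ñ.natDegree = π₀.natDegree * 14 := by
    rw [hÑ, natDegree_pullback hπi.ne_zero (by rw [hdegA₀, hdegB₀]; norm_num), hdegA₀]
  have hd0 : 0 < π₀.natDegree := hπi.natDegree_pos
  have hÑ0 : Ñ ≠ 0 := fun h => by
    rw [h, natDegree_zero] at hÑdeg
    omega
  have hÑsep : Ñ.Separable := pullback_separable hπi hπm hπX hπX1 hcop0 hW0 hÑ0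
  have hÑS : IsCoprime Ñ (X * 𝔠(K)) := by
    have hÑB : IsCoprime Ñ B₀ := isCoprime_pullback_right hπi.ne_zero hcop0
    have hÑA : IsCoprime Ñ A₀ := isCoprime_pullback_left h0 hcop0
    rw [hB₀, isCoprime_C_mul_right_iff (by norm_num)] at hÑB
    rw [hA₀] at hÑA
    exact hÑB.mul_right hÑA.of_mul_right_left
  -- the double pull-back `M = 𝒩(Ñ)` is separable
  have hM0 : 𝒩(Ñ) ≠ 0 := pullback_ne_zero hÑ0 hK0 htr
  have hMsep : Polynomial.Separable 𝒩(Ñ) :=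
    pullback_separable_of_isCoprime hÑsep hÑS hNK (rd_wronskian_dvd H) hM0
  -- `M(u) = 𝔎(u)^{deg Ñ} (B₀(x))^{deg π₀} π₀(𝔤)`
  have hNu : ⟪𝔑⟫ ≠ 0 := aeval_ratFunc_X_ne_zero hN0
  set x : RatFunc K := ⟪𝔑⟫ / ⟪𝔎⟫ with hx
  have hx0 : x ≠ 0 := div_ne_zero hNu hKu
  have hBx : aeval x B₀ = algebraMap K (RatFunc K) (-1728) * x := by rw [hB₀, map_mul, aeval_C, aeval_X]
  have hBx0 : aeval x B₀ ≠ 0 := by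
    rw [hBx]; exact mul_ne_zero ((_root_.map_ne_zero _).2 (by norm_num)) hx0
  have hcomp : 𝔤 = aeval x A₀ / aeval x B₀ := seedM_eq_comp H
  have hval1 : aeval x Ñ = aeval x B₀ ^ π₀.natDegree * aeval 𝔤 π₀ := by
    rw [hÑ, aeval_pullback_eq π₀ A₀ B₀ hBx0, ← hcomp]
  have hval2 : ⟪𝒩(Ñ)⟫ = ⟪𝔎⟫ ^ Ñ.natDegree * aeval x Ñ := aeval_pullback_eq Ñ _ _ hKu
  subst hgdef
  have hpf0 : aeval 𝔤 π₀ ≠ 0 := (seedM_transcendental H).2.2 π₀ hπi.ne_zero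
  have hordBx : P.ord (aeval x B₀) = 0 := by
    rw [hBx, P.ord_mul_eq ((_root_.map_ne_zero _).2 (by norm_num)) hx0,
      PlaceOver.ord_algebraMap_holds P (by norm_num), hx, P.ord_div hNu hKu, hNz, hKz]; norm_num
  have hordM : P.ord ⟪𝒩(Ñ)⟫ = P.ord (aeval 𝔤 π₀) := by
    rw [hval2, hval1, P.ord_mul_eq (pow_ne_zero _ hKu) (mul_ne_zero (pow_ne_zero _ hBx0) hpf0),
      P.ord_pow hKu, hKz, P.ord_mul_eq (pow_ne_zero _ hBx0) hpf0, P.ord_pow hBx0, hordBx]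
    ring
  have h := P.ord_aeval_eq_one_of_separable_of_finrank_eq_one hut hu1 hMsep (by rw [hordM]; exact hP)
  rwa [hordM] at h

/-- **The radicand at the zeros of `𝔤`**: `v(𝔤) = 2` and `3 ∣ v(𝔥) = 0`. [folklore] -/
theorem seedM_zeros (H : RD(a, b)) {r₁ r₂ : K} (hr : 𝔞(K) = (X - C r₁) * (X - C r₂))
    {g h : RatFunc K} (hgdef : g = 𝔤) (hhdef : h = 𝔥(r₁, r₂))
    (P : PlaceOver K (RatFunc K)) (hP : 0 < P.ord g) : P.ord g = 2 ∧ ((3 : ℕ) : ℤ) ∣ P.ord h := by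
  rcases seedM_cases H hr hgdef hhdef P with ⟨hg, -⟩ | ⟨hg, -, hh, -⟩ | ⟨hg, -⟩ | ⟨-, -, -, -, hg, -⟩
  · omega
  · exact ⟨hg, by rw [hh]; exact dvd_zero _⟩
  · omega
  · omega

/-- **The radicand at the zeros of `𝔤 - 1`, of the two kinds**: either `v(𝔤 - 1) = 3` and `3 ∣ v(𝔥)`
(the triple points `ℬ(u) = 0`), or `3 v(𝔤 - 1) = 3` and `v(𝔥) ∈ {1, 2}` is prime to `3` (the simple points
`𝒜(u) = 0`, totally ramified in the layer) — the hypothesis of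
`PlaceOver.ord_algebraMap_eq_of_forall_ord_pos_mixed`. [folklore] -/
theorem seedM_ones (H : RD(a, b)) {r₁ r₂ : K} (hr : 𝔞(K) = (X - C r₁) * (X - C r₂))
    {g h : RatFunc K} (hgdef : g = 𝔤) (hhdef : h = 𝔥(r₁, r₂))
    (P : PlaceOver K (RatFunc K)) (hP : 0 < P.ord (g - 1)) :
    (P.ord (g - 1) = 3 ∧ ((3 : ℕ) : ℤ) ∣ P.ord h) ∨
      (((3 : ℕ) : ℤ) * P.ord (g - 1) = 3 ∧ IsCoprime (P.ord h) ((3 : ℕ) : ℤ)) := by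
  rcases seedM_cases H hr hgdef hhdef P with
      ⟨hg, hg1, -⟩ | ⟨-, hg, -⟩ | ⟨-, hab, -⟩ | ⟨-, -, -, -, -, hg, -⟩
  · omega
  · omega
  · exact_mod_cast hab
  · omega

/-- **At the poles the seed is uniform**: `v(𝔤) = -13` and `3 ∣ v(𝔥)` (phrased as the hypothesis of
`PlaceOver.ord_algebraMap_eq_of_forall_ord_neg_mixed`, whose second alternative does not occur). [folklore] -/
theorem seedM_poles (H : RD(a, b)) {r₁ r₂ : K} (hr : 𝔞(K) = (X - C r₁) * (X - C r₂))
    {g h : RatFunc K} (hgdef : g = 𝔤) (hhdef : h = 𝔥(r₁, r₂))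
    (P : PlaceOver K (RatFunc K)) (hP : P.ord g < 0) :
    (P.ord g = -13 ∧ ((3 : ℕ) : ℤ) ∣ P.ord h) ∨
      (((3 : ℕ) : ℤ) * P.ord g = -13 ∧ IsCoprime (P.ord h) ((3 : ℕ) : ℤ)) := by
  rcases seedM_cases H hr hgdef hhdef P with ⟨-, -, hg, hh, -⟩ | ⟨hg, -⟩ | ⟨hg, -⟩ | ⟨-, -, -, -, hg, -⟩
  · left; exact ⟨hg, by exact_mod_cast hh⟩
  · omega
  · omega
  · omega

/-- At the other closed points the radicand is a unit. [folklore] -/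
theorem seedM_elsewhere_dvd (H : RD(a, b)) {r₁ r₂ : K} (hr : 𝔞(K) = (X - C r₁) * (X - C r₂))
    {g h : RatFunc K} (hgdef : g = 𝔤) (hhdef : h = 𝔥(r₁, r₂))
    {π₀ : K[X]} (hπi : Irreducible π₀) (hπm : π₀.Monic) (hπX : π₀ ≠ X) (hπX1 : π₀ ≠ X - 1)
    (P : PlaceOver K (RatFunc K)) (hP : 0 < P.ord (aeval g π₀)) :
    P.ord (aeval g π₀) = 1 ∧ ((3 : ℕ) : ℤ) ∣ P.ord h := by
  obtain ⟨h1, hh⟩ := seedM_elsewhere H hr hgdef hhdef hπi hπm hπX hπX1 P hP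
  exact ⟨h1, by rw [hh]; exact dvd_zero _⟩

/-! ### F. One Kummer layer of degree `3`: the covering of signature `(2, 3, 13)` -/

/-- **One Kummer layer over the composite seed: a covering of signature `(2, 3, 13)`** over (the full
constant field inside `F₁` of) any number field `K` containing a primitive cube root of unity `ζ`:
`F₁ = K(u)(w)`, `w³ = 𝔥 = 𝔓₁(r₁) 𝔓₁(r₂)²` (`r₁ = 3ζ - 1`, `r₂ = -3ζ - 4` the roots of `𝔞`), and
`f = 𝔤 = 1 - j₁₃(x(u))/1728`: zeros of order `2`, zeros of `f - 1` of order `3` (the layer is unramified at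
the triple points and totally ramified at the `52` simple ones), poles of order `13`, unramified elsewhere.
The covering has degree `1092 = |PSL₂(𝔽₁₃)|` and genus `50`, those of `X(13) → X(1)`.
[cite: Stichtenoth2009, Prop. 3.7.3] [cite: DarmonGranville1995, Prop. 3.1 (p. 525), signature `(2, 3, 13)`] -/
theorem exists_belyiMap_signature_two_three_thirteen_aux [NumberField K] (H : RD(a, b)) {ζ : K}
    (hζ : ζ ^ 2 + ζ + 1 = 0) :
    ∃ (K' : Type u) (_ : Field K') (_ : NumberField K') (F : Type u) (_ : Field F) (_ : Algebra K' F)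
      (_ : IsAlgFunctionField K' F) (_ : IsIntegrallyClosedIn K' F) (f : F),
      f ∉ Set.range (algebraMap K' F) ∧
      (∀ P : PlaceOver K' F, 0 < P.ord f → P.ord f = 2) ∧
      (∀ P : PlaceOver K' F, 0 < P.ord (f - 1) → P.ord (f - 1) = 3) ∧
      (∀ P : PlaceOver K' F, P.ord f < 0 → P.ord f = -13) ∧
      (∀ π₀ : K'[X], Irreducible π₀ → π₀.Monic → π₀ ≠ X → π₀ ≠ X - 1 →
        ∀ P : PlaceOver K' F, 0 < P.ord (aeval f π₀) → P.ord (aeval f π₀) = 1) := by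
  haveI : CharZero (RatFunc K) :=
    charZero_of_injective_algebraMap (algebraMap K (RatFunc K)).injective
  have h3 : 0 < 3 := by norm_num
  have h3K : ((3 : ℕ) : K) ≠ 0 := Nat.cast_ne_zero.2 (by norm_num)
  have hr := thA_eq_mul hζ
  obtain ⟨-, -, -, -, -, -, -, -, hP10⟩ := seedM_natDegree H (3 * ζ - 1)
  obtain ⟨-, -, -, -, -, -, -, -, hP20⟩ := seedM_natDegree H (-3 * ζ - 4)
  have hh0 : 𝔥(3 * ζ - 1, -3 * ζ - 4) ≠ 0 :=
    aeval_ratFunc_X_ne_zero (mul_ne_zero hP10 (pow_ne_zero _ hP20))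
  -- the Kummer layer
  obtain ⟨F₁, _, _, _, _, _, _, w, hw, hgen⟩ := exists_radical_extension (K := K) (F := RatFunc K)
    𝔥(3 * ζ - 1, -3 * ζ - 4) h3
  haveI hAF₁ : IsAlgFunctionField K F₁ :=
    isAlgFunctionField_of_finiteDimensional (K := K) (F := RatFunc K)
  set f : F₁ := algebraMap (RatFunc K) F₁ 𝔤 with hf
  have hft : Transcendental K f :=
    (transcendental_algebraMap_iff (algebraMap (RatFunc K) F₁).injective).2 (seedM_transcendental H).2.1
  have h₀ : ∀ R : PlaceOver K F₁, 0 < R.ord f → R.ord f = 2 := fun R hR =>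
    PlaceOver.ord_algebraMap_eq_of_forall_ord_pos_of_dvd (K := K) (F := RatFunc K) (F' := F₁) h3 h3K
      hh0 hw hgen (fun Q hQ => seedM_zeros H hr rfl rfl Q hQ) R hR
  have hi' : ∀ R : PlaceOver K F₁, R.ord f < 0 → R.ord f = -13 := fun R hR =>
    PlaceOver.ord_algebraMap_eq_of_forall_ord_neg_mixed (K := K) (F := RatFunc K) (F' := F₁) h3 h3K
      hh0 hw hgen (p₀ := -13) (fun Q hQ => seedM_poles H hr rfl rfl Q hQ) R hR
  have h₁ : ∀ R : PlaceOver K F₁, 0 < R.ord (f - 1) → R.ord (f - 1) = 3 := by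
    intro R hR
    have heq : f - 1 = algebraMap (RatFunc K) F₁ (𝔤 - 1) := by
      simp only [hf, map_sub, map_one]
    rw [heq] at hR ⊢
    exact PlaceOver.ord_algebraMap_eq_of_forall_ord_pos_mixed (K := K) (F := RatFunc K) (F' := F₁) h3
      h3K hh0 hw hgen (p₀ := 3) (fun Q hQ => seedM_ones H hr rfl rfl Q hQ) R hR
  have hunr : ∀ π₀ : K[X], Irreducible π₀ → π₀.Monic → π₀ ≠ X → π₀ ≠ X - 1 →
      ∀ R : PlaceOver K F₁, 0 < R.ord (aeval f π₀) → R.ord (aeval f π₀) = 1 := by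
    intro π₀ hπi hπm hX hX1 R hR
    have heq : aeval f π₀ = algebraMap (RatFunc K) F₁ (aeval 𝔤 π₀) := by
      rw [hf, aeval_algebraMap_apply]
    rw [heq] at hR ⊢
    exact PlaceOver.ord_algebraMap_eq_of_forall_ord_pos_of_dvd (K := K) (F := RatFunc K) (F' := F₁) h3
      h3K hh0 hw hgen (fun Q hQ => seedM_elsewhere_dvd H hr rfl rfl hπi hπm hX hX1 Q hQ) R hR
  obtain ⟨K', _, _, _, _, _, hfK', h₀', h₁', hi'', hunr'⟩ :=
    exists_fullConstantField_of_signature (K := K) (F := F₁) hft h₀ h₁ hi' hunr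
  exact ⟨K', inferInstance, inferInstance, F₁, inferInstance, inferInstance, inferInstance,
    inferInstance, f, hfK', h₀', h₁', hi'', hunr'⟩

/-- **The hypotheses hold for `(𝔄, 𝔅)`**: degrees `13, 12`, `𝔄² - 13 𝔅² = (X² - 13)¹³`,
`𝔄'𝔅 - 𝔄𝔅' = 13 (X² - 13)¹²`, and `X² - 13` is prime to `𝔅` and to `𝔄 - 3𝔅`. [folklore] -/
theorem rd_hyp : RD(𝔄(K), 𝔅(K)) :=
  ⟨natDegree_rdA, natDegree_rdB, rdA_sq_sub, wronskian_rdA_rdB, isCoprime_rdD.1, isCoprime_rdD.2⟩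

end Seed

section Cover

/-- **A covering of signature `(2, 3, 13)` over a number field**, in the shape of the covering input of
`finite_properSolutions_of_belyiMap_of_faltings`: the construction over the cyclotomic field `ℚ(ζ₃)`
with the Rédei forms `(𝔄, 𝔅)`. It has the degree `1092`, the genus `50` and the signature of the modular
covering `X(13) → X(1)`, and is obtained here from the `j`-map of `X₀(13) ≅ ℙ¹` (over `ℚ`) by two genus-`0`
uniformising substitutions and one Kummer layer of degree `3`; no Riemann existence theorem is used.
[cite: Stichtenoth2009, Prop. 3.7.3] [cite: DarmonGranville1995, Prop. 3.1 (p. 525), signature `(2, 3, 13)`] -/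
theorem exists_belyiMap_signature_two_three_thirteen :
    ∃ (K : Type) (_ : Field K) (_ : NumberField K) (F : Type) (_ : Field F) (_ : Algebra K F)
      (_ : IsAlgFunctionField K F) (_ : IsIntegrallyClosedIn K F) (f : F),
      f ∉ Set.range (algebraMap K F) ∧
      (∀ P : PlaceOver K F, 0 < P.ord f → P.ord f = 2) ∧
      (∀ P : PlaceOver K F, 0 < P.ord (f - 1) → P.ord (f - 1) = 3) ∧
      (∀ P : PlaceOver K F, P.ord f < 0 → P.ord f = -13) ∧
      (∀ π₀ : K[X], Irreducible π₀ → π₀.Monic → π₀ ≠ X → π₀ ≠ X - 1 →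
        ∀ P : PlaceOver K F, 0 < P.ord (aeval f π₀) → P.ord (aeval f π₀) = 1) := by
  haveI : NeZero (3 : ℕ) := ⟨by norm_num⟩
  obtain ⟨ζ, hζ⟩ := @IsCyclotomicExtension.exists_isPrimitiveRoot {3} ℚ (CyclotomicField 3 ℚ) _ _ _
    (CyclotomicField.isCyclotomicExtension 3 ℚ) 3 (Set.mem_singleton 3) (NeZero.ne 3)
  have hζ3 : ζ ^ 3 = 1 := hζ.pow_eq_one
  have hζ1 : ζ ≠ 1 := hζ.ne_one (by norm_num)
  have hζ' : ζ ^ 2 + ζ + 1 = 0 := by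
    have h : (ζ - 1) * (ζ ^ 2 + ζ + 1) = 0 := by linear_combination hζ3
    exact (mul_eq_zero.mp h).resolve_left (sub_ne_zero.mpr hζ1)
  exact exists_belyiMap_signature_two_three_thirteen_aux (K := CyclotomicField 3 ℚ) rd_hyp hζ'

end Cover

end AlgFunctionField

/-! ### G. Darmon–Granville for the signatures `(p, q, r)` with `2 ∣ p`, `3 ∣ q`, `13 ∣ r`, modulo Faltings -/

section DarmonGranville

open AlgFunctionField

/-- **`A x^p + B y^q = C z^r` has finitely many proper solutions whenever `2 ∣ p`, `3 ∣ q`, `13 ∣ r`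
(`p q r ≠ 0`), modulo Faltings' theorem** (`finite_ratPlaces_of_two_le_genus`): the covering
`exists_belyiMap_signature_two_three_thirteen` fed into `finite_properSolutions_of_belyiMap_of_faltings`
gives `(2, 3, 13)` (hyperbolic: `1/2 + 1/3 + 1/13 = 71/78`), and `finite_properSolutions_of_dvd` the
multiples. In particular `x² + y³ = z¹³` has finitely many proper solutions modulo Faltings only. No Riemann
existence theorem is used. [cite: DarmonGranville1995, Theorem 2 (p. 515)] -/
theorem finite_properSolutions_signature_two_three_thirteen_of_faltings {p q r : ℕ}
    (hp : 2 ∣ p) (hq : 3 ∣ q) (hr : 13 ∣ r) (hp0 : p ≠ 0) (hq0 : q ≠ 0) (hr0 : r ≠ 0)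
    (hFaltings : ∀ (K' : Type) [Field K'] (F' : Type) [Field F'] [Algebra K' F'],
      finite_ratPlaces_of_two_le_genus K' F')
    {A B C : ℤ} (hA : A ≠ 0) (hB : B ≠ 0) (hC : C ≠ 0) :
    {t : ℤ × ℤ × ℤ | ({t.1, t.2.1, t.2.2} : Finset ℤ).gcd id = 1 ∧
      A * t.1 ^ p + B * t.2.1 ^ q = C * t.2.2 ^ r}.Finite := by
  obtain ⟨K, _, _, F, _, _, _, _, f, hf, h₀, h₁, hi, hunr⟩ := exists_belyiMap_signature_two_three_thirteen
  have hhyp : 3 * 13 + 13 * 2 + 2 * 3 < 2 * 3 * 13 := by norm_num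
  exact finite_properSolutions_of_dvd hp hq hr hp0 hq0 hr0
    (finite_properSolutions_of_belyiMap_of_faltings hhyp hf h₀ h₁ (by exact_mod_cast hi) hunr hFaltings
      hA hB hC)

/-- **`A x^r + B y² = C z³` has finitely many proper solutions for every `r ≠ 0` divisible by `13`,
modulo Faltings' theorem only** — in particular for `r = 13`, `169`, `2197`, whose triangle groups
`Δ(2, 3, r)` are perfect. [cite: DarmonGranville1995, Theorem 2 (p. 515)] -/
theorem finite_properSolutions_signature_thirteen_two_three_of_faltings {r : ℕ} (hr0 : r ≠ 0) (h13 : 13 ∣ r)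
    (hFaltings : ∀ (K' : Type) [Field K'] (F' : Type) [Field F'] [Algebra K' F'],
      finite_ratPlaces_of_two_le_genus K' F')
    {A B C : ℤ} (hA : A ≠ 0) (hB : B ≠ 0) (hC : C ≠ 0) :
    {t : ℤ × ℤ × ℤ | ({t.1, t.2.1, t.2.2} : Finset ℤ).gcd id = 1 ∧
      A * t.1 ^ r + B * t.2.1 ^ 2 = C * t.2.2 ^ 3}.Finite := by
  have h23 : ∀ A B C : ℤ, A ≠ 0 → B ≠ 0 → C ≠ 0 →
      {t : ℤ × ℤ × ℤ | ({t.1, t.2.1, t.2.2} : Finset ℤ).gcd id = 1 ∧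
        A * t.1 ^ 2 + B * t.2.1 ^ 3 = C * t.2.2 ^ r}.Finite := fun A B C hA hB hC =>
    finite_properSolutions_signature_two_three_thirteen_of_faltings dvd_rfl dvd_rfl h13 two_ne_zero
      three_ne_zero hr0 hFaltings hA hB hC
  exact forall_finite_properSolutions_swap₁₂ (forall_finite_properSolutions_swap₂₃ h23) A B C hA hB hC

/-- **`A x^r + B y² = C z³` has finitely many proper solutions for every `r ≥ 7` having a prime factor in
`{2, 3, 5, 7, 13}`, modulo Faltings' theorem only** — the union of the dihedral, tetrahedral, icosahedral,
level-`7` and level-`13` constructions. The remaining `r` (prime to `30030/11 = 2730`: `11, 17, 19, 23, …,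
121, 187, …`) are not treated (they would need the modular curves `X(p)`, `p = 11` or `p ≥ 17`, which have
no genus-`0` quotient over which to build a Kummer tower except `X(11)/A₅`).
[cite: DarmonGranville1995, Theorem 2 (p. 515)] -/
theorem finite_properSolutions_signature_r_two_three_of_faltings_of_dvd {r : ℕ}
    (hr : 7 ≤ r) (h : 2 ∣ r ∨ 3 ∣ r ∨ 5 ∣ r ∨ 7 ∣ r ∨ 13 ∣ r)
    (hFaltings : ∀ (K' : Type) [Field K'] (F' : Type) [Field F'] [Algebra K' F'],
      finite_ratPlaces_of_two_le_genus K' F')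
    {A B C : ℤ} (hA : A ≠ 0) (hB : B ≠ 0) (hC : C ≠ 0) :
    {t : ℤ × ℤ × ℤ | ({t.1, t.2.1, t.2.2} : Finset ℤ).gcd id = 1 ∧
      A * t.1 ^ r + B * t.2.1 ^ 2 = C * t.2.2 ^ 3}.Finite := by
  by_cases h13 : 13 ∣ r
  · exact finite_properSolutions_signature_thirteen_two_three_of_faltings (by omega) h13 hFaltings hA hB hC
  · have h2357 : 2 ∣ r ∨ 3 ∣ r ∨ 5 ∣ r ∨ 7 ∣ r := by tauto
    exact finite_properSolutions_signature_r_two_three_of_faltings_of_not_coprime hr h2357 hFaltings hA hB hC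

end DarmonGranville

end Literature.NumberTheory.DiophantineGeometry
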